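import Mathlib
import Literature.Computability.Complexity.KKLTheorem
import Literature.Computability.Complexity.FriedgutJuntaTheorem
import HarnessLib

/-!
# Edge-isoperimetry in the discrete cube: Harper's inequality (proved: logarithmic form §1, exact
# form §6) and the stability theorems of Ellis (2011) and Ellis–Keller–Lifshitz (2018); Friedgut's
# junta theorem (discharged, §5) and KKL (discharged, §4) as quoted there

Source followed (held, statements page-confirmed): D. Ellis, N. Keller, N. Lifshitz, *On the structure
of subsets of the discrete cube with small edge boundary*, Discrete Analysis 2018:9 [EllisKellerLifshitz2018]
(held text `paper:arxiv-1612.06680` = arXiv:1612.06680v?; `pNNNN` below = chunk of the held text), §1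
(Theorems 1.3, 1.4, 1.5, 1.7 and the KKL display) and §2 (notation).

SETTING [EllisKellerLifshitz2018, §1 p0003]: "`Q_n` [is] the graph with vertex-set `{0,1}ⁿ`, where two
0-1 vectors are adjacent if they differ in exactly one coordinate … We may identify `{0,1}ⁿ` with the
power-set `P([n])` … two sets `S, T ⊂ [n]` are adjacent if `|S Δ T| = 1`"; "`∂A` [is] the edge boundary of
`A` with respect to `Q_n`" = the set of edges joining `A` to its complement. Here a family is
`𝓕 : Finset (Finset (Fin n))` and `edgeBoundary 𝓕 = |∂𝓕|` counts each boundary edge `{S, S Δ {i}}` once,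
from its endpoint `S ∈ 𝓕` (`edgeBoundaryIn X 𝓕` is the same count inside the cube on a ground set `X`,
used for the induction). "The lexicographic ordering on `P([n])` is defined by `S > T` iff
`min(S Δ T) ∈ S`" (`LexGT`); "the initial segment of the lexicographic ordering of size `m` is … the `m`
largest elements" — since `>` is a strict total order (the minimum of a nonempty `S Δ T` lies in exactly
one of `S`, `T`), the initial segments are exactly the UP-CLOSED families (`IsLexInitialSegment`), the one
of size `m` being unique. "`𝓕` and `𝓖` are weakly isomorphic if there exists an automorphism `φ` of `Q_n`
such that `𝓖 = φ(𝓕)` … iff `𝓖` can be obtained from `𝓕` by permuting the coordinates and interchanging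
`0`'s with `1`'s on some subset of the coordinates" (`IsWeaklyIsomorphic`, the second form). Subcubes
`S_B^C = {S : S ∩ B = C}` [ibid., §2 p0007] (`subcube B C`, dimension `n − |B|`); "`𝓖` depends upon `k`
coordinates if there exists `S ⊂ [n]` with `|S| = k`, such that `(T ∈ 𝓖) ⇔ (T ∩ S ∈ 𝓖)` holds for all
`T ⊂ [n]`" [ibid., after Thm 1.7, p0005] (`DependsOn`); influences `Inf_i[𝓕] = |{A : |𝓕 ∩ {A, A Δ {i}}| = 1}|/2ⁿ`,
`I[𝓕] = Σ_i Inf_i[𝓕] = |∂𝓕|/2^{n−1}` [ibid., pp0004–0005] (`influence`, `totalInfluence`).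

WHAT IS HERE.
* PROVED: the edge-isoperimetric inequality in its logarithmic form `|∂𝓕| ≥ |𝓕| · log₂(2ⁿ/|𝓕|)` —
  [EllisKellerLifshitz2018, §1 p0005]: "for families with measure `|𝓕|/2ⁿ ∈ [α, 1−α]`, Theorem 1.3
  implies that `I[𝓕] ≥ 2α log₂(1/α)`", i.e. `|∂𝓕| ≥ |𝓕|(n − log₂|𝓕|)` (Harper 1964 / Bernstein / Hart) —
  `card_mul_sub_logb_le_edgeBoundary` (and `…In` on any ground set), by the classical induction on the
  ground set: splitting along a coordinate `a`, `|∂𝓕| ≥ |∂𝓕₀| + |∂𝓕₁| + ||𝓕₀| − |𝓕₁||`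
  (`edgeBoundaryIn_insert_ge`), closed by the two-point inequality
  `(x+y) log₂(x+y) − x log₂ x − y log₂ y ≥ 2 min(x,y)` (`two_mul_min_le_entropy`, from monotonicity of
  `u ↦ (u+1) ln(u+1) − u ln u`); corollary `pow_mul_sub_le_edgeBoundary` (`|𝓕| = 2^d ⇒ |∂𝓕| ≥ 2^d (n−d)`,
  the value at a `d`-dimensional subcube).
* PROVED (§6): the EXACT edge-isoperimetric inequality `Harper1964_edgeIso` =
  [EllisKellerLifshitz2018, Thm 1.3] (lexicographic initial segments minimise `|∂|`), discharged as
  `Harper1964_edgeIso_holds`: with Harper's extremal function `h(m) = Σ_{k<m} s₂(k)` (`binEdgeCount`),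
  every family of `m` subsets of an `N`-set has `N·m ≤ |∂𝓕| + 2h(m)` (`card_mul_card_le_edgeBoundaryIn_add`,
  the induction of §1 closed by `h(a) + h(b) + min(a,b) ≤ h(a+b)`, `binEdgeCount_superadditive`) and
  initial segments attain equality (`edgeBoundaryIn_lexSegment`, induction along the most significant
  coordinate, `h(2^k + m) = h(2^k) + h(m) + m`); the exact splitting identity is `edgeBoundaryIn_insert_eq`.
* NAMED FACTS (published theorems not proved here, D-0014; unprinted absolute constants typed as one
  constant quantified outermost): `Ellis2011_thm` =
  [ibid., Thm 1.4], `EllisKellerLifshitz2018_thm15` = [ibid., Thm 1.5] (stability for ALL sizes, sharp up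
  to the constant), `Friedgut1998_junta` = [ibid., Thm 1.7] (Friedgut's junta theorem as quoted),
  `KahnKalaiLinial1988_thm` = [ibid., display p0005] (KKL as quoted) — these last two DISCHARGED: §4
  (`KahnKalaiLinial1988_thm_holds`, `c₀ = 1/50`, from the proved cube-Fourier KKL theorem
  `Literature.Computability.Complexity.LowDegree.KKL.kkl` of `Computability/Complexity/KKLTheorem.lean`,
  O'Donnell 2014 §9.6) and §5 (`Friedgut1998_junta_holds`, `C = 17`, from the proved
  `Literature.Computability.Complexity.LowDegree.KKL.friedgut_junta_exp` of
  `Computability/Complexity/FriedgutJuntaTheorem.lean`, O'Donnell 2014 Thm 9.28).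

Consumer: cell pnp-psdrank (summit PneNP) — the SPARSE-regime structure theorems for the cut side of the
`r = 1` rung (`Literature.Combinatorics.Optimization.RectangleDecayBal`), per the cell's LIT-30 §3
("small total influence ⇒ close to a subcube = pin-junta: Ellis 2011; Ellis–Keller–Lifshitz Thm 1.5, all
sizes"); companion of `AssociationSchemes/SliceFKN.lean`, `SliceKindlerSafra.lean` (the 99%-regime
slice theorems). Label: support / instrument; nothing here concerns psd rank or P vs NP. No instances,
no notation, standard axioms.

## References
* [EllisKellerLifshitz2018] D. Ellis, N. Keller, N. Lifshitz, Discrete Analysis 2018:9, arXiv:1612.06680.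
* [Ellis2011] D. Ellis, *Almost isoperimetric subsets of the discrete cube*, Combin. Probab. Comput. 20
  (2011) 363–380 (Thm 1.4 as quoted).
* [Harper1964] L. H. Harper, *Optimal assignments of numbers to vertices*, J. SIAM 12 (1964) 131–135
  (with Lindsey, Bernstein, Hart: the edge-isoperimetric inequality, Thm 1.3 as quoted).
* [Friedgut1998] E. Friedgut, *Boolean functions with low average sensitivity depend on few coordinates*,
  Combinatorica 18 (1998) 27–35 (Thm 1.7 as quoted).
* [KahnKalaiLinial1988] J. Kahn, G. Kalai, N. Linial, *The influence of variables on Boolean functions*,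
  FOCS 1988, 68–80 (the KKL display as quoted).
* [ODonnell2014] R. O'Donnell, *Analysis of Boolean Functions*, CUP 2014, §9.6 (the proofs of KKL and of
  Friedgut's junta theorem, Thm 9.28, used in §4–§5).
-/

noncomputable section

open Finset
open scoped BigOperators symmDiff

namespace Literature.Combinatorics.SetFamily

namespace CubeEdgeIsoperimetry

/-! ### §1 Edge boundary in the cube on a ground set; the classical induction -/

section General

variable {α : Type*} [DecidableEq α]

/-- **Edge boundary inside the cube `P(X)`**: the number of pairs `(S, i)`, `S ∈ 𝓕`, `i ∈ X`, with
`S Δ {i} ∉ 𝓕` — each edge `{S, S Δ {i}}` of the cube on the ground set `X` leaving `𝓕` is counted once,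
from its endpoint in `𝓕`. [cite: EllisKellerLifshitz2018, §1 (p0003, "the edge boundary of A consists of the set of edges which join a vertex in A to a vertex in V ∖ A")] -/
def edgeBoundaryIn (X : Finset α) (𝓕 : Finset (Finset α)) : ℕ :=
  ((𝓕 ×ˢ X).filter fun p : Finset α × α => p.1 ∆ {p.2} ∉ 𝓕).card

/-- Membership in `S Δ {a}` (the neighbour of `S` across coordinate `a`). [cite: EllisKellerLifshitz2018, §1 (p0003, "S, T are adjacent if |S Δ T| = 1")] -/
private theorem mem_symmDiff_singleton {S : Finset α} {a x : α} :
    x ∈ S ∆ ({a} : Finset α) ↔ (x ∈ S ∧ x ≠ a) ∨ (x = a ∧ x ∉ S) := by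
  rw [Finset.mem_symmDiff, mem_singleton]

/-- `S Δ {a} = insert a S` when `a ∉ S`. [cite: EllisKellerLifshitz2018, §1 (p0003)] -/
private theorem symmDiff_singleton_of_not_mem {S : Finset α} {a : α} (ha : a ∉ S) :
    S ∆ ({a} : Finset α) = insert a S := by
  ext x
  rw [mem_symmDiff_singleton, mem_insert]
  constructor
  · rintro (⟨hx, -⟩ | ⟨rfl, -⟩)
    · exact Or.inr hx
    · exact Or.inl rfl
  · rintro (rfl | hx)
    · exact Or.inr ⟨rfl, ha⟩
    · exact Or.inl ⟨hx, fun h => ha (h ▸ hx)⟩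

/-- `S Δ {a} = S.erase a` when `a ∈ S`. [cite: EllisKellerLifshitz2018, §1 (p0003)] -/
private theorem symmDiff_singleton_of_mem {S : Finset α} {a : α} (ha : a ∈ S) :
    S ∆ ({a} : Finset α) = S.erase a := by
  ext x
  rw [mem_symmDiff_singleton, mem_erase]
  constructor
  · rintro (⟨hx, hxa⟩ | ⟨rfl, hx⟩)
    · exact ⟨hxa, hx⟩
    · exact absurd ha hx
  · rintro ⟨hxa, hx⟩
    exact Or.inl ⟨hx, hxa⟩

/-- `a ∉ S Δ {i}` when `a ∉ S` and `i ≠ a`. [cite: EllisKellerLifshitz2018, §1 (p0003)] -/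
private theorem not_mem_symmDiff_singleton {S : Finset α} {a i : α} (ha : a ∉ S) (hi : i ≠ a) :
    a ∉ S ∆ ({i} : Finset α) := by
  rw [mem_symmDiff_singleton]
  rintro (⟨h, -⟩ | ⟨h, -⟩)
  · exact ha h
  · exact hi h.symm

/-- `(insert a T) Δ {i} = insert a (T Δ {i})` for `i ≠ a`. [cite: EllisKellerLifshitz2018, §1 (p0003)] -/
private theorem insert_symmDiff_singleton {T : Finset α} {a i : α} (hi : i ≠ a) :
    (insert a T) ∆ ({i} : Finset α) = insert a (T ∆ {i}) := by
  ext x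
  simp only [mem_symmDiff_singleton, mem_insert]
  constructor
  · rintro (⟨rfl | hx, hxa⟩ | ⟨rfl, hx⟩)
    · exact Or.inl rfl
    · exact Or.inr (Or.inl ⟨hx, hxa⟩)
    · exact Or.inr (Or.inr ⟨rfl, fun h => hx (Or.inr h)⟩)
  · rintro (rfl | ⟨hx, hxa⟩ | ⟨rfl, hx⟩)
    · exact Or.inl ⟨Or.inl rfl, hi.symm⟩
    · exact Or.inl ⟨Or.inr hx, hxa⟩
    · exact Or.inr ⟨rfl, fun h => h.elim (fun h => hi h) hx⟩

/-- **The splitting inequality of the classical induction.** For `a ∉ X` and a family `𝓕` (of subsets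
of `X ∪ {a}`, though this is not needed), with `𝓕₀ = {S ∈ 𝓕 : a ∉ S}` and `𝓕₁ = {S ∖ {a} : S ∈ 𝓕, a ∈ S}`:
`|∂𝓕| ≥ |∂𝓕₀| + |∂𝓕₁| + |𝓕₀ ∖ 𝓕₁| + |𝓕₁ ∖ 𝓕₀|` — boundary edges in directions `≠ a` inside the two
half-cubes, plus the edges in direction `a`. [cite: Harper1964, pp. 131–135 (the inductive argument)] -/
theorem edgeBoundaryIn_insert_ge {X : Finset α} {a : α} (ha : a ∉ X) (𝓕 : Finset (Finset α)) :
    edgeBoundaryIn X (𝓕.filter fun S => a ∉ S) +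
        edgeBoundaryIn X ((𝓕.filter fun S => a ∈ S).image fun S => S.erase a) +
        ((𝓕.filter fun S => a ∉ S) \ ((𝓕.filter fun S => a ∈ S).image fun S => S.erase a)).card +
        (((𝓕.filter fun S => a ∈ S).image fun S => S.erase a) \ (𝓕.filter fun S => a ∉ S)).card ≤
      edgeBoundaryIn (insert a X) 𝓕 := by
  classical
  set 𝓕₀ := 𝓕.filter fun S => a ∉ S with h𝓕₀_def
  set 𝓕₁ := (𝓕.filter fun S => a ∈ S).image fun S => S.erase a with h𝓕₁_def
  -- membership characterisations
  have mem0 : ∀ {S}, S ∈ 𝓕₀ ↔ S ∈ 𝓕 ∧ a ∉ S := fun {S} => by rw [h𝓕₀_def, mem_filter]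
  have mem1 : ∀ {T}, T ∈ 𝓕₁ ↔ a ∉ T ∧ insert a T ∈ 𝓕 := by
    intro T
    rw [h𝓕₁_def, mem_image]
    constructor
    · rintro ⟨S, hS, rfl⟩
      rw [mem_filter] at hS
      exact ⟨notMem_erase a S, by rw [insert_erase hS.2]; exact hS.1⟩
    · rintro ⟨haT, hT⟩
      exact ⟨insert a T, mem_filter.2 ⟨hT, mem_insert_self a T⟩, erase_insert haT⟩
  -- the boundary pair set of `𝓕`
  set B := (𝓕 ×ˢ insert a X).filter fun p : Finset α × α => p.1 ∆ {p.2} ∉ 𝓕 with hB_def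
  have memB : ∀ {p : Finset α × α}, p ∈ B ↔ (p.1 ∈ 𝓕 ∧ p.2 ∈ insert a X) ∧ p.1 ∆ {p.2} ∉ 𝓕 := by
    intro p; rw [hB_def, mem_filter, mem_product]
  -- the four images
  set I₁ := (𝓕₀ ×ˢ X).filter fun p : Finset α × α => p.1 ∆ {p.2} ∉ 𝓕₀ with hI₁_def
  set J₂ := (𝓕₁ ×ˢ X).filter fun p : Finset α × α => p.1 ∆ {p.2} ∉ 𝓕₁ with hJ₂_def
  set I₂ := J₂.image fun p : Finset α × α => (insert a p.1, p.2) with hI₂_def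
  set I₃ := (𝓕₀ \ 𝓕₁).image fun S : Finset α => (S, a) with hI₃_def
  set I₄ := (𝓕₁ \ 𝓕₀).image fun T : Finset α => (insert a T, a) with hI₄_def
  have hXa : ∀ {i}, i ∈ X → i ≠ a := fun {i} hi h => ha (h ▸ hi)
  -- (1) `I₁ ⊆ B`
  have h1 : I₁ ⊆ B := by
    intro p hp
    rw [hI₁_def, mem_filter, mem_product] at hp
    obtain ⟨⟨hS, hi⟩, hout⟩ := hp
    refine memB.2 ⟨⟨(mem0.1 hS).1, mem_insert_of_mem hi⟩, fun hin => hout (mem0.2 ⟨hin, ?_⟩)⟩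
    exact not_mem_symmDiff_singleton (mem0.1 hS).2 (hXa hi)
  -- (2) `I₂ ⊆ B`
  have h2 : I₂ ⊆ B := by
    intro q hq
    rw [hI₂_def, mem_image] at hq
    obtain ⟨p, hp, rfl⟩ := hq
    rw [hJ₂_def, mem_filter, mem_product] at hp
    obtain ⟨⟨hT, hi⟩, hout⟩ := hp
    obtain ⟨haT, hins⟩ := mem1.1 hT
    refine memB.2 ⟨⟨hins, mem_insert_of_mem hi⟩, fun hin => hout (mem1.2 ⟨?_, ?_⟩)⟩
    · exact not_mem_symmDiff_singleton haT (hXa hi)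
    · simpa [insert_symmDiff_singleton (hXa hi)] using hin
  -- (3) `I₃ ⊆ B`
  have h3 : I₃ ⊆ B := by
    intro q hq
    rw [hI₃_def, mem_image] at hq
    obtain ⟨S, hS, rfl⟩ := hq
    rw [mem_sdiff] at hS
    obtain ⟨hS₀, hS₁⟩ := hS
    obtain ⟨hS𝓕, haS⟩ := mem0.1 hS₀
    refine memB.2 ⟨⟨hS𝓕, mem_insert_self a X⟩, fun hin => hS₁ (mem1.2 ⟨haS, ?_⟩)⟩
    simpa [symmDiff_singleton_of_not_mem haS] using hin
  -- (4) `I₄ ⊆ B`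
  have h4 : I₄ ⊆ B := by
    intro q hq
    rw [hI₄_def, mem_image] at hq
    obtain ⟨T, hT, rfl⟩ := hq
    rw [mem_sdiff] at hT
    obtain ⟨hT₁, hT₀⟩ := hT
    obtain ⟨haT, hins⟩ := mem1.1 hT₁
    refine memB.2 ⟨⟨hins, mem_insert_self a X⟩, fun hin => hT₀ (mem0.2 ⟨?_, haT⟩)⟩
    simpa [symmDiff_singleton_of_mem (mem_insert_self a T), erase_insert haT] using hin
  -- first/second coordinate tests separating the four images
  have c1 : ∀ p ∈ I₁, a ∉ p.1 ∧ p.2 ≠ a := fun p hp => by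
    rw [hI₁_def, mem_filter, mem_product] at hp
    exact ⟨(mem0.1 hp.1.1).2, hXa hp.1.2⟩
  have c2 : ∀ p ∈ I₂, a ∈ p.1 ∧ p.2 ≠ a := fun p hp => by
    rw [hI₂_def, mem_image] at hp
    obtain ⟨q, hq, rfl⟩ := hp
    rw [hJ₂_def, mem_filter, mem_product] at hq
    exact ⟨mem_insert_self _ _, hXa hq.1.2⟩
  have c3 : ∀ p ∈ I₃, a ∉ p.1 ∧ p.2 = a := fun p hp => by
    rw [hI₃_def, mem_image] at hp
    obtain ⟨S, hS, rfl⟩ := hp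
    exact ⟨(mem0.1 (mem_sdiff.1 hS).1).2, rfl⟩
  have c4 : ∀ p ∈ I₄, a ∈ p.1 ∧ p.2 = a := fun p hp => by
    rw [hI₄_def, mem_image] at hp
    obtain ⟨T, hT, rfl⟩ := hp
    exact ⟨mem_insert_self _ _, rfl⟩
  have d12 : Disjoint I₁ I₂ := disjoint_left.2 fun p hp hp' => (c1 p hp).1 (c2 p hp').1
  have d13 : Disjoint I₁ I₃ := disjoint_left.2 fun p hp hp' => (c1 p hp).2 (c3 p hp').2
  have d14 : Disjoint I₁ I₄ := disjoint_left.2 fun p hp hp' => (c1 p hp).1 (c4 p hp').1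
  have d23 : Disjoint I₂ I₃ := disjoint_left.2 fun p hp hp' => (c3 p hp').1 (c2 p hp).1
  have d24 : Disjoint I₂ I₄ := disjoint_left.2 fun p hp hp' => (c2 p hp).2 (c4 p hp').2
  have d34 : Disjoint I₃ I₄ := disjoint_left.2 fun p hp hp' => (c3 p hp).1 (c4 p hp').1
  -- cardinalities of the images
  have card2 : I₂.card = J₂.card := by
    rw [hI₂_def]
    refine card_image_of_injOn fun p hp q hq hpq => ?_
    have hp' := (mem_filter.1 (mem_coe.1 hp)).1
    have hq' := (mem_filter.1 (mem_coe.1 hq)).1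
    rw [mem_product] at hp' hq'
    have hap : a ∉ p.1 := (mem1.1 hp'.1).1
    have haq : a ∉ q.1 := (mem1.1 hq'.1).1
    simp only [Prod.mk.injEq] at hpq
    refine Prod.ext ?_ hpq.2
    rw [← erase_insert hap, hpq.1, erase_insert haq]
  have card3 : I₃.card = (𝓕₀ \ 𝓕₁).card := by
    rw [hI₃_def]
    exact card_image_of_injective _ fun S T h => by simpa using h
  have card4 : I₄.card = (𝓕₁ \ 𝓕₀).card := by
    rw [hI₄_def]
    refine card_image_of_injOn fun S hS T hT hST => ?_
    have haS : a ∉ S := (mem1.1 (mem_sdiff.1 (mem_coe.1 hS)).1).1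
    have haT : a ∉ T := (mem1.1 (mem_sdiff.1 (mem_coe.1 hT)).1).1
    simp only [Prod.mk.injEq, and_true] at hST
    rw [← erase_insert haS, hST, erase_insert haT]
  -- assemble
  have hsub : I₁ ∪ I₂ ∪ I₃ ∪ I₄ ⊆ B :=
    union_subset (union_subset (union_subset h1 h2) h3) h4
  have hcard : (I₁ ∪ I₂ ∪ I₃ ∪ I₄).card = I₁.card + I₂.card + I₃.card + I₄.card := by
    rw [card_union_of_disjoint (disjoint_union_left.2 ⟨disjoint_union_left.2 ⟨d14, d24⟩, d34⟩),
      card_union_of_disjoint (disjoint_union_left.2 ⟨d13, d23⟩), card_union_of_disjoint d12]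
  have := card_le_card hsub
  rw [hcard, card2, card3, card4] at this
  simpa [edgeBoundaryIn, hB_def, hI₁_def, hJ₂_def] using this

/-! ### The two-point inequality -/

/-- `u ↦ (u+1) ln(u+1) − u ln u` is monotone on `[1, ∞)` (its derivative is `ln((u+1)/u) ≥ 0`) — the
calculus behind the two-point inequality of the inductive proof. [cite: Harper1964, pp. 131–135 (the inductive argument)] -/
theorem monotoneOn_succ_mul_log_sub_mul_log :
    MonotoneOn (fun u : ℝ => (u + 1) * Real.log (u + 1) - u * Real.log u) (Set.Ici 1) := by
  have hderiv : ∀ u : ℝ, 0 < u →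
      HasDerivAt (fun u : ℝ => (u + 1) * Real.log (u + 1) - u * Real.log u)
        (Real.log (u + 1) - Real.log u) u := by
    intro u hu
    have h1 : HasDerivAt (fun u : ℝ => (u + 1) * Real.log (u + 1)) (Real.log (u + 1) + 1) u := by
      have := (Real.hasDerivAt_mul_log (show u + 1 ≠ 0 by linarith)).comp u
        ((hasDerivAt_id u).add_const 1)
      simpa [Function.comp_def] using this
    have h2 : HasDerivAt (fun u : ℝ => u * Real.log u) (Real.log u + 1) u :=
      Real.hasDerivAt_mul_log hu.ne'
    exact (h1.sub h2).congr_deriv (by ring)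
  refine monotoneOn_of_deriv_nonneg (convex_Ici 1) ?_ ?_ ?_
  · exact ((Real.continuous_mul_log.comp (continuous_id.add continuous_const)).sub
      Real.continuous_mul_log).continuousOn
  · intro u hu
    rw [interior_Ici] at hu
    exact (hderiv u (by linarith [Set.mem_Ioi.1 hu])).differentiableAt.differentiableWithinAt
  · intro u hu
    rw [interior_Ici] at hu
    have hu1 : 1 < u := Set.mem_Ioi.1 hu
    rw [(hderiv u (by linarith)).deriv]
    have := Real.log_le_log (by linarith) (show u ≤ u + 1 by linarith)
    linarith

/-- **The two-point inequality** behind the edge-isoperimetric induction: for `x ≥ y ≥ 0`,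
`(x+y) ln(x+y) − x ln x − y ln y ≥ 2 y ln 2` (equality at `y = 0` and `y = x`). [cite: Harper1964, pp. 131–135 (the inductive argument)] -/
theorem two_mul_log_two_le_entropy {x y : ℝ} (hy : 0 ≤ y) (hyx : y ≤ x) :
    2 * y * Real.log 2 ≤ (x + y) * Real.log (x + y) - x * Real.log x - y * Real.log y := by
  rcases hy.eq_or_lt with rfl | hy0
  · simp
  have hx0 : 0 < x := lt_of_lt_of_le hy0 hyx
  -- `χ(x/y) ≥ χ(1) = 2 ln 2` for `χ(u) = (u+1) ln(u+1) − u ln u`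
  have hmono := monotoneOn_succ_mul_log_sub_mul_log (Set.mem_Ici.2 le_rfl)
    (Set.mem_Ici.2 ((one_le_div hy0).2 hyx)) ((one_le_div hy0).2 hyx)
  simp only [Real.log_one, mul_zero, sub_zero] at hmono
  norm_num at hmono
  -- multiply by `y` and expand the logarithms of quotients
  have hxy : x / y + 1 = (x + y) / y := by field_simp
  rw [hxy, Real.log_div (by linarith) hy0.ne', Real.log_div hx0.ne' hy0.ne'] at hmono
  have := mul_le_mul_of_nonneg_left hmono hy
  have hy' : y * ((x + y) / y * (Real.log (x + y) - Real.log y) - x / y * (Real.log x - Real.log y)) =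
      (x + y) * Real.log (x + y) - x * Real.log x - y * Real.log y := by
    field_simp
    ring
  rw [hy'] at this
  linarith

/-- The two-point inequality in base `2`: `2 min(x,y) ≤ (x+y) log₂(x+y) − x log₂ x − y log₂ y` for
`x, y ≥ 0`. [cite: Harper1964, pp. 131–135 (the inductive argument)] -/
theorem two_mul_min_le_entropy {x y : ℝ} (hx : 0 ≤ x) (hy : 0 ≤ y) :
    2 * min x y ≤ (x + y) * Real.logb 2 (x + y) - x * Real.logb 2 x - y * Real.logb 2 y := by
  have hlog2 : 0 < Real.log 2 := Real.log_pos one_lt_two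
  simp only [Real.logb]
  rw [show (x + y) * (Real.log (x + y) / Real.log 2) - x * (Real.log x / Real.log 2) -
      y * (Real.log y / Real.log 2) =
      ((x + y) * Real.log (x + y) - x * Real.log x - y * Real.log y) / Real.log 2 by ring,
    le_div_iff₀ hlog2]
  rcases le_total y x with hyx | hxy
  · rw [min_eq_right hyx]
    have := two_mul_log_two_le_entropy hy hyx
    linarith
  · rw [min_eq_left hxy]
    have := two_mul_log_two_le_entropy hx hxy
    have hcomm : (y + x) * Real.log (y + x) - y * Real.log y - x * Real.log x =
        (x + y) * Real.log (x + y) - x * Real.log x - y * Real.log y := by rw [add_comm y x]; ring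
    linarith

/-! ### The edge-isoperimetric inequality, logarithmic form (proved) -/

/-- **Edge-isoperimetric inequality in the cube `P(X)`, logarithmic form** (Harper–Bernstein–Hart):
for every family `𝓕 ⊆ P(X)`, `|𝓕| · (|X| − log₂|𝓕|) ≤ |∂𝓕|`, i.e. `|∂𝓕| ≥ |𝓕| log₂(2^{|X|}/|𝓕|)`.
Proof: induction on `X` with `edgeBoundaryIn_insert_ge` and `two_mul_min_le_entropy`.
[cite: EllisKellerLifshitz2018, §1 (p0005, "Theorem 1.3 implies that I[𝓕] ≥ 2α log₂(1/α)")] [cite: Harper1964, pp. 131–135] -/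
theorem card_mul_sub_logb_le_edgeBoundaryIn (X : Finset α) :
    ∀ 𝓕 : Finset (Finset α), (∀ S ∈ 𝓕, S ⊆ X) →
      (𝓕.card : ℝ) * ((X.card : ℝ) - Real.logb 2 𝓕.card) ≤ edgeBoundaryIn X 𝓕 := by
  classical
  induction X using Finset.induction_on with
  | empty =>
    intro 𝓕 h𝓕
    -- `𝓕 ⊆ {∅}`
    have hsub : 𝓕 ⊆ {∅} := fun S hS => mem_singleton.2 (subset_empty.1 (h𝓕 S hS))
    have hc : 𝓕.card ≤ 1 := by simpa using card_le_card hsub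
    interval_cases h : 𝓕.card <;> simp
  | insert a X ha ih =>
    intro 𝓕 h𝓕
    set 𝓕₀ := 𝓕.filter fun S => a ∉ S with h𝓕₀_def
    set 𝓕₁ := (𝓕.filter fun S => a ∈ S).image fun S => S.erase a with h𝓕₁_def
    have h0X : ∀ S ∈ 𝓕₀, S ⊆ X := fun S hS => by
      rw [h𝓕₀_def, mem_filter] at hS
      exact (subset_insert_iff_of_notMem hS.2).1 (h𝓕 S hS.1)
    have h1X : ∀ S ∈ 𝓕₁, S ⊆ X := fun S hS => by
      rw [h𝓕₁_def, mem_image] at hS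
      obtain ⟨T, hT, rfl⟩ := hS
      rw [mem_filter] at hT
      intro x hx
      rw [mem_erase] at hx
      exact mem_of_mem_insert_of_ne (h𝓕 T hT.1 hx.2) hx.1
    have ih0 := ih 𝓕₀ h0X
    have ih1 := ih 𝓕₁ h1X
    have hsplit := edgeBoundaryIn_insert_ge ha 𝓕
    -- cardinalities
    have hc1 : 𝓕₁.card = (𝓕.filter fun S => a ∈ S).card := by
      rw [h𝓕₁_def]
      exact card_image_of_injOn fun S hS T hT hST => by
        have haS : a ∈ S := (mem_filter.1 (mem_coe.1 hS)).2
        have haT : a ∈ T := (mem_filter.1 (mem_coe.1 hT)).2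
        simpa [insert_erase haS, insert_erase haT] using congrArg (insert a) hST
    have hsum : (𝓕.card : ℝ) = 𝓕₀.card + 𝓕₁.card := by
      rw [hc1, h𝓕₀_def, ← Nat.cast_add, add_comm, card_filter_add_card_filter_not]
    have hXcard : ((insert a X).card : ℝ) = X.card + 1 := by
      rw [card_insert_of_notMem ha, Nat.cast_add, Nat.cast_one]
    -- `|c₀ − c₁| ≤ |𝓕₀ \ 𝓕₁| + |𝓕₁ \ 𝓕₀|`
    have hd0 : (𝓕₀.card : ℝ) ≤ (𝓕₀ \ 𝓕₁).card + 𝓕₁.card := by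
      exact_mod_cast card_le_card_sdiff_add_card
    have hd1 : (𝓕₁.card : ℝ) ≤ (𝓕₁ \ 𝓕₀).card + 𝓕₀.card := by
      exact_mod_cast card_le_card_sdiff_add_card
    have hsplitR : (edgeBoundaryIn X 𝓕₀ : ℝ) + edgeBoundaryIn X 𝓕₁ + (𝓕₀ \ 𝓕₁).card +
        (𝓕₁ \ 𝓕₀).card ≤ edgeBoundaryIn (insert a X) 𝓕 := by exact_mod_cast hsplit
    have htwo := two_mul_min_le_entropy (Nat.cast_nonneg 𝓕₀.card) (Nat.cast_nonneg 𝓕₁.card)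
    -- `|c₀ − c₁| = c₀ + c₁ − 2 min`
    have hminabs : (𝓕₀.card : ℝ) + 𝓕₁.card - 2 * min (𝓕₀.card : ℝ) 𝓕₁.card ≤
        (𝓕₀ \ 𝓕₁).card + (𝓕₁ \ 𝓕₀).card := by
      rcases le_total (𝓕₀.card : ℝ) 𝓕₁.card with h | h
      · rw [min_eq_left h]; linarith
      · rw [min_eq_right h]; linarith
    rw [hsum, hXcard]
    have e1 : ((𝓕₀.card : ℝ) + 𝓕₁.card) * ((X.card : ℝ) + 1 - Real.logb 2 ((𝓕₀.card : ℝ) + 𝓕₁.card)) =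
        (𝓕₀.card : ℝ) * ((X.card : ℝ) - Real.logb 2 𝓕₀.card) +
          (𝓕₁.card : ℝ) * ((X.card : ℝ) - Real.logb 2 𝓕₁.card) + ((𝓕₀.card : ℝ) + 𝓕₁.card) -
          (((𝓕₀.card : ℝ) + 𝓕₁.card) * Real.logb 2 ((𝓕₀.card : ℝ) + 𝓕₁.card) -
            (𝓕₀.card : ℝ) * Real.logb 2 𝓕₀.card - (𝓕₁.card : ℝ) * Real.logb 2 𝓕₁.card) := by
      ring
    rw [e1]
    linarith [ih0, ih1, hsplitR, htwo, hminabs]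

end General

/-! ### §2 The discrete cube `Q_n = P([n])`: vocabulary of [EllisKellerLifshitz2018] -/

variable {n : ℕ}

/-- **`|∂𝓕|`, the edge boundary in `Q_n`** of a family `𝓕 ⊆ P([n])` (each edge `{S, S Δ {i}}` with
`S ∈ 𝓕`, `S Δ {i} ∉ 𝓕` counted once). [cite: EllisKellerLifshitz2018, §1 (p0003)] -/
def edgeBoundary (𝓕 : Finset (Finset (Fin n))) : ℕ := edgeBoundaryIn univ 𝓕

/-- The `i`th **influence** `Inf_i[𝓕] = |{A ⊆ [n] : |𝓕 ∩ {A, A Δ {i}}| = 1}| / 2ⁿ`.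
[cite: EllisKellerLifshitz2018, §1 (p0004, display defining Inf_i)] -/
def influence (i : Fin n) (𝓕 : Finset (Finset (Fin n))) : ℝ :=
  ((univ.filter fun A : Finset (Fin n) => (A ∈ 𝓕 ∧ A ∆ {i} ∉ 𝓕) ∨ (A ∉ 𝓕 ∧ A ∆ {i} ∈ 𝓕)).card : ℝ)
    / 2 ^ n

/-- The **total influence** `I[𝓕] = Σ_i Inf_i[𝓕] = |∂𝓕| / 2^{n−1}` — typed by the displayed identity
("the total influence of a set is none other than the size of its edge boundary, appropriately
normalised"; for `n = 0` the `ℕ`-subtraction reads `2^{0−1} = 1`, immaterial since then `∂𝓕 = ∅`).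
[cite: EllisKellerLifshitz2018, §1 (p0005) and §2 (p0007, display I[𝓕] = |∂𝓕|/2^{n−1})] -/
def totalInfluence (𝓕 : Finset (Finset (Fin n))) : ℝ := (edgeBoundary 𝓕 : ℝ) / 2 ^ (n - 1)

/-- **The lexicographic ordering on `P([n])`**: "`S > T` iff `min(S Δ T) ∈ S`" (a strict total order:
the minimum of a nonempty `S Δ T` lies in exactly one of `S`, `T`). [cite: EllisKellerLifshitz2018, §1 (p0003)] -/
def LexGT (S T : Finset (Fin n)) : Prop := ∃ h : (S ∆ T).Nonempty, (S ∆ T).min' h ∈ S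

/-- **`𝓛` is an initial segment of the lexicographic ordering** ("lexicographically ordered"): with
every member it contains all lexicographically LARGER sets — "the initial segment … of size `m` is
simply the subset of `P([n])` consisting of the `m` largest elements"; as `>` is a strict total order,
the up-closed families are exactly the initial segments, one of each size.
[cite: EllisKellerLifshitz2018, §1 (p0003) and §2 (p0007, "lexicographically ordered")] -/
def IsLexInitialSegment (𝓛 : Finset (Finset (Fin n))) : Prop :=
  ∀ S ∈ 𝓛, ∀ T : Finset (Fin n), LexGT T S → T ∈ 𝓛

/-- The lexicographic order is total: two distinct sets are comparable (the minimum of the nonempty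
`S Δ T` lies in `S` or in `T`), so the up-closed families are exactly the initial segments.
[cite: EllisKellerLifshitz2018, §1 (p0003)] -/
theorem lexGT_or_lexGT_of_ne {S T : Finset (Fin n)} (h : S ≠ T) : LexGT S T ∨ LexGT T S := by
  have hne : (S ∆ T).Nonempty := by
    rw [nonempty_iff_ne_empty, Ne, Finset.symmDiff_eq_empty]
    exact h
  have hmem := min'_mem (S ∆ T) hne
  rw [Finset.mem_symmDiff] at hmem
  rcases hmem with ⟨hS, -⟩ | ⟨hT, -⟩
  · exact Or.inl ⟨hne, hS⟩
  · refine Or.inr ⟨by rwa [symmDiff_comm], ?_⟩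
    have : T ∆ S = S ∆ T := symmDiff_comm T S
    simp only [this]
    exact hT

/-- The lexicographic order is asymmetric. [cite: EllisKellerLifshitz2018, §1 (p0003)] -/
theorem not_lexGT_of_lexGT {S T : Finset (Fin n)} (h : LexGT S T) : ¬ LexGT T S := by
  rintro ⟨hne, hT⟩
  obtain ⟨hne', hS⟩ := h
  have heq : (T ∆ S).min' hne = (S ∆ T).min' hne' := by
    congr 1
    exact symmDiff_comm T S
  rw [heq] at hT
  have hmem := min'_mem (S ∆ T) hne'
  rw [Finset.mem_symmDiff] at hmem
  rcases hmem with ⟨-, hnT⟩ | ⟨-, hnS⟩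
  · exact hnT hT
  · exact hnS hS

/-- **Weak isomorphism**: "`𝓖` can be obtained from `𝓕` by permuting the coordinates `1, 2, …, n` and
interchanging `0`'s with `1`'s on some subset of the coordinates" (= `𝓖 = φ(𝓕)` for an automorphism
`φ` of `Q_n`). [cite: EllisKellerLifshitz2018, §1 (p0003–p0004)] -/
def IsWeaklyIsomorphic (𝓕 𝓖 : Finset (Finset (Fin n))) : Prop :=
  ∃ (σ : Equiv.Perm (Fin n)) (D : Finset (Fin n)), 𝓖 = 𝓕.image fun S => (S.map σ.toEmbedding) ∆ D

/-- **The subcube `S_B^C = {S ⊆ [n] : S ∩ B = C}`** (`C ⊆ B`; dimension `n − |B|`; `S_B = S_B^B`).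
[cite: EllisKellerLifshitz2018, §2 (p0007)] -/
def subcube (B C : Finset (Fin n)) : Finset (Finset (Fin n)) := univ.filter fun S => S ∩ B = C

/-- **"`𝓖` depends upon the coordinates `S`"**: "`(T ∈ 𝓖) ⇔ (T ∩ S ∈ 𝓖)` holds for all `T ⊂ [n]`"
(so `𝓖` depends upon `|S|` coordinates). [cite: EllisKellerLifshitz2018, §1 (p0005, after Thm 1.7)] -/
def DependsOn (𝓖 : Finset (Finset (Fin n))) (S : Finset (Fin n)) : Prop := ∀ T, T ∈ 𝓖 ↔ T ∩ S ∈ 𝓖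

/-- **Edge-isoperimetric inequality in `Q_n`, logarithmic form (proved)**:
`|𝓕| · (n − log₂|𝓕|) ≤ |∂𝓕|`, i.e. `|∂𝓕| ≥ |𝓕| · log₂(2ⁿ/|𝓕|)`; in influence language
`I[𝓕] ≥ 2μ log₂(1/μ)`, `μ = |𝓕|/2ⁿ`. [cite: EllisKellerLifshitz2018, §1 (p0005)] [cite: Harper1964, pp. 131–135] -/
theorem card_mul_sub_logb_le_edgeBoundary (𝓕 : Finset (Finset (Fin n))) :
    (𝓕.card : ℝ) * ((n : ℝ) - Real.logb 2 𝓕.card) ≤ edgeBoundary 𝓕 := by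
  have h := card_mul_sub_logb_le_edgeBoundaryIn (univ : Finset (Fin n)) 𝓕 fun S _ => subset_univ S
  simpa [edgeBoundary] using h

/-- **Corollary (the subcube value)**: if `|𝓕| = 2^d` then `|∂𝓕| ≥ 2^d (n − d)` — the edge boundary of
a `d`-dimensional subcube ("if `|𝓕|` is a power of 2, then equality holds iff `𝓕` is a subcube").
[cite: EllisKellerLifshitz2018, §1 (p0004)] [cite: Harper1964, pp. 131–135] -/
theorem pow_mul_sub_le_edgeBoundary (𝓕 : Finset (Finset (Fin n))) {d : ℕ} (hd : 𝓕.card = 2 ^ d) :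
    (2 : ℝ) ^ d * ((n : ℝ) - d) ≤ edgeBoundary 𝓕 := by
  have h := card_mul_sub_logb_le_edgeBoundary 𝓕
  rw [hd, Nat.cast_pow, Nat.cast_two, Real.logb_pow, Real.logb_self_eq_one one_lt_two, mul_one] at h
  exact h

/-! ### §3 Named facts: the edge-isoperimetric inequality (lex form) and its stability theorems -/

/-- **The edge-isoperimetric inequality for `Q_n`** (Harper, Lindsey, Bernstein, Hart)
[EllisKellerLifshitz2018, Thm 1.3, verbatim]: "If `𝓕 ⊂ P([n])`, then `|∂𝓕| ≥ |∂𝓛|`, where `𝓛 ⊂ P([n])`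
is the initial segment of the lexicographic ordering of size `|𝓕|`." (Equality iff `𝓕` is weakly
isomorphic to `𝓛`; for `|𝓕| = 2^d`, iff `𝓕` is a subcube, ibid. p0004. The logarithmic consequence is
PROVED above.) Named fact, DISCHARGED below (`Harper1964_edgeIso_holds`, §6).
[cite: EllisKellerLifshitz2018, Thm 1.3 (p0003)] [cite: Harper1964, pp. 131–135 (the theorem, as restated in EllisKellerLifshitz2018 Thm 1.3)] -/
def Harper1964_edgeIso : Prop :=
  ∀ (n : ℕ) (𝓕 𝓛 : Finset (Finset (Fin n))), IsLexInitialSegment 𝓛 → 𝓛.card = 𝓕.card →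
    edgeBoundary 𝓛 ≤ edgeBoundary 𝓕

/-- **Ellis' stability theorem for sets of size `2^d`** [EllisKellerLifshitz2018, Thm 1.4, verbatim,
= Ellis 2011]: "There exists an absolute constant `c > 0` such that the following holds. Let
`0 ≤ δ < c`. If `𝓕 ⊂ P([n])` with `|𝓕| = 2^d` for some `d ∈ ℕ`, and `|𝓕 Δ 𝓒| ≥ δ 2^d` for all
`d`-dimensional subcubes `𝓒 ⊂ P([n])`, then `|∂𝓕| ≥ |∂𝓒| + 2^d δ log₂(1/δ)`." (`|∂𝓒| = 2^d (n − d)`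
for a `d`-dimensional subcube `𝓒 = S_B^C`, `|B| = n − d`.) NAMED FACT, not proved here.
[cite: EllisKellerLifshitz2018, Thm 1.4 (p0004)] [cite: Ellis2011, pp. 363–380 (main theorem, as restated in EllisKellerLifshitz2018 Thm 1.4)] -/
def Ellis2011_thm : Prop :=
  ∃ c : ℝ, 0 < c ∧ ∀ (δ : ℝ), 0 ≤ δ → δ < c → ∀ (n d : ℕ) (𝓕 : Finset (Finset (Fin n))),
    𝓕.card = 2 ^ d →
    (∀ B C : Finset (Fin n), C ⊆ B → B.card = n - d → δ * 2 ^ d ≤ ((𝓕 ∆ subcube B C).card : ℝ)) →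
      (2 : ℝ) ^ d * ((n : ℝ) - d) + 2 ^ d * δ * Real.logb 2 (1 / δ) ≤ edgeBoundary 𝓕

/-- **Ellis–Keller–Lifshitz' stability theorem for the edge-isoperimetric inequality**
[EllisKellerLifshitz2018, Thm 1.5, verbatim]: "There exists an absolute constant `C > 0` such that
the following holds. If `𝓕 ⊂ P([n])` and `𝓛 ⊂ P([n])` is the initial segment of the lexicographic ordering
with `|𝓛| = |𝓕|`, then there exists a family `𝓖 ⊂ P([n])` weakly isomorphic to `𝓛`, such that
`|𝓕 Δ 𝓖| ≤ C(|∂𝓕| − |∂𝓛|)`." (Sharp up to the value of the absolute constant `C`, ibid. Example 1.6.)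
NAMED FACT, not proved here. [cite: EllisKellerLifshitz2018, Thm 1.5 (p0004)] -/
def EllisKellerLifshitz2018_thm15 : Prop :=
  ∃ C : ℝ, 0 < C ∧ ∀ (n : ℕ) (𝓕 𝓛 : Finset (Finset (Fin n))), IsLexInitialSegment 𝓛 →
    𝓛.card = 𝓕.card →
      ∃ 𝓖 : Finset (Finset (Fin n)), IsWeaklyIsomorphic 𝓛 𝓖 ∧
        ((𝓕 ∆ 𝓖).card : ℝ) ≤ C * ((edgeBoundary 𝓕 : ℝ) - edgeBoundary 𝓛)

/-- **Friedgut's junta theorem**, in the form printed as [EllisKellerLifshitz2018, Thm 1.7]: "There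
exists an absolute constant `C` such that the following holds. Let `ε > 0`, and let `𝓕 ⊂ P([n])`. Then
there exists `𝓖 ⊂ P([n])` depending upon at most `2^{C I[𝓕]/ε}` coordinates, such that
`|𝓕 Δ 𝓖| ≤ ε 2ⁿ`." Named fact, DISCHARGED below (`Friedgut1998_junta_holds`, §5, with `C = 17`).
[cite: EllisKellerLifshitz2018, Thm 1.7 (p0005)] [cite: Friedgut1998, pp. 27–35 (main theorem, as restated in EllisKellerLifshitz2018 Thm 1.7)] -/
def Friedgut1998_junta : Prop :=
  ∃ C : ℝ, 0 < C ∧ ∀ (ε : ℝ), 0 < ε → ∀ (n : ℕ) (𝓕 : Finset (Finset (Fin n))),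
    ∃ (𝓖 : Finset (Finset (Fin n))) (S : Finset (Fin n)), DependsOn 𝓖 S ∧
      (S.card : ℝ) ≤ (2 : ℝ) ^ (C * totalInfluence 𝓕 / ε) ∧ ((𝓕 ∆ 𝓖).card : ℝ) ≤ ε * 2 ^ n

/-- **The KKL theorem**, in the form printed in [EllisKellerLifshitz2018, §1 p0005]: "for any Boolean
function `f : {0,1}ⁿ → {0,1}` with `E[f] = μ`, there exists `i ∈ [n]` such that
`Inf_i[f] ≥ c₀ μ(1−μ) (log n)/n`, where `c₀` is an absolute constant" (typed for the family
`𝓕 = {x : f(x) = 1}`, `μ = |𝓕|/2ⁿ`, `n ≥ 1`, natural logarithm). Named fact, DISCHARGED below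
(`KahnKalaiLinial1988_thm_holds`, §4, with `c₀ = 1/50`).
[cite: EllisKellerLifshitz2018, §1 (p0005, KKL display)] [cite: KahnKalaiLinial1988, pp. 68–80 (main theorem, as restated in EllisKellerLifshitz2018 §1)] -/
def KahnKalaiLinial1988_thm : Prop :=
  ∃ c₀ : ℝ, 0 < c₀ ∧ ∀ (n : ℕ) (𝓕 : Finset (Finset (Fin n))), 1 ≤ n →
    ∃ i : Fin n, c₀ * ((𝓕.card : ℝ) / 2 ^ n) * (1 - (𝓕.card : ℝ) / 2 ^ n) * (Real.log n / n) ≤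
      influence i 𝓕

/-! ### §4 Discharge of `KahnKalaiLinial1988_thm` (appended 2026-08-28; the Fourier-analytic core —
O'Donnell's proof of the KKL theorem via the KKL edge-isoperimetric inequality and
`(4/3, 2)`-hypercontractivity — is `Literature.Computability.Complexity.LowDegree.KKL.kkl`, file
`Computability/Complexity/KKLTheorem.lean`). A family `𝓕 ⊆ P([n])` is read as the `±1`-valued function
`F(x) = −1` if `{i : x_i = 1} ∈ 𝓕`, `+1` otherwise, on the cube `{0,1}ⁿ` (`x : Fin n → Bool`); then
`Var[F] = 4 μ (1 − μ)` (`μ = |𝓕|/2ⁿ`) and `Inf_i[F] = Inf_i[𝓕]`. -/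

section DischargeKKL

open Literature.Computability.Complexity.LowDegree (cubeFourierCoeff)
open Literature.Probability.RandomGraphs.LowDegree (walsh)

/-- Sums over the cube `{0,1}ⁿ` are sums over `P([n])` along `x ↦ {i : x_i = 1}`.
[cite: EllisKellerLifshitz2018, §1 (p0005: "Boolean function f : {0,1}ⁿ → {0,1}" ↔ family 𝓕 = {x : f(x) = 1})] -/
theorem sum_cube_eq_sum_powerset (φ : Finset (Fin n) → ℝ) :
    ∑ x : Fin n → Bool, φ (univ.filter fun i => x i = true) = ∑ A : Finset (Fin n), φ A := by
  let e : (Fin n → Bool) ≃ Finset (Fin n) :=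
    { toFun := fun x => univ.filter fun i => x i = true
      invFun := fun A i => decide (i ∈ A)
      left_inv := fun x => funext fun i => by simp
      right_inv := fun A => Finset.ext fun i => by simp }
  exact Fintype.sum_equiv e _ _ fun _ => rfl

/-- Flipping the `i`th bit of `x` changes `{j : x_j = 1}` to its symmetric difference with `{i}`.
[cite: EllisKellerLifshitz2018, §1 (p0004, Inf_i via A ↦ A Δ {i})] -/
theorem filter_update_not (x : Fin n → Bool) (i : Fin n) :
    (univ.filter fun j => Function.update x i (!x i) j = true) =
      (univ.filter fun j => x j = true) ∆ {i} := by
  ext j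
  simp only [mem_filter, mem_univ, true_and, mem_symmDiff, mem_singleton]
  by_cases hj : j = i
  · subst hj; rw [Function.update_self]; cases x j <;> simp
  · rw [Function.update_of_ne hj]; simp [hj]

/-- **Discharge of the named fact `KahnKalaiLinial1988_thm` (the Kahn–Kalai–Linial theorem), with
`c₀ = 1/50`** (natural logarithm): read `𝓕` as the `±1`-valued `F` above; `KKL.kkl` gives a coordinate with
`Inf_i[F] ≥ (1/200) Var[F] log n / n`, and `Var[F] = 1 − F̂(∅)² = 4μ(1−μ)`, `Inf_i[F] = Inf_i[𝓕]`.
[cite: KahnKalaiLinial1988, pp. 68–80 (main theorem)] [cite: ODonnell2014, §9.6 (KKL Theorem)]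
[cite: EllisKellerLifshitz2018, §1 (p0005, KKL display)] -/
theorem KahnKalaiLinial1988_thm_holds : KahnKalaiLinial1988_thm := by
  refine ⟨1 / 50, by norm_num, ?_⟩
  intro n 𝓕 hn
  classical
  set F : (Fin n → Bool) → ℝ :=
    fun x => if (univ.filter fun j => x j = true) ∈ 𝓕 then -1 else 1 with hF_def
  have hF : ∀ x, F x = 1 ∨ F x = -1 := fun x => by
    rw [hF_def]; simp only; split_ifs
    · exact Or.inr rfl
    · exact Or.inl rfl
  obtain ⟨i, hi⟩ := Literature.Computability.Complexity.LowDegree.KKL.kkl hn F hF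
  refine ⟨i, ?_⟩
  -- the influence of `F` is the influence of `𝓕`
  have hpt : ∀ x : Fin n → Bool,
      (if F x ≠ F (Function.update x i (!x i)) then (1 : ℝ) else 0) =
        if ((univ.filter fun j => x j = true) ∈ 𝓕 ∧ (univ.filter fun j => x j = true) ∆ {i} ∉ 𝓕) ∨
            ((univ.filter fun j => x j = true) ∉ 𝓕 ∧ (univ.filter fun j => x j = true) ∆ {i} ∈ 𝓕)
          then (1 : ℝ) else 0 := by
    intro x
    simp only [hF_def, filter_update_not x i]
    by_cases h1 : (univ.filter fun j => x j = true) ∈ 𝓕 <;>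
      by_cases h2 : (univ.filter fun j => x j = true) ∆ {i} ∈ 𝓕 <;> norm_num [h1, h2]
  have hInf : Literature.Computability.Complexity.LowDegree.KKL.influence i F = influence i 𝓕 := by
    unfold Literature.Computability.Complexity.LowDegree.KKL.influence influence
    congr 1
    rw [sum_congr rfl fun x _ => hpt x,
      sum_cube_eq_sum_powerset (fun A => if (A ∈ 𝓕 ∧ A ∆ {i} ∉ 𝓕) ∨ (A ∉ 𝓕 ∧ A ∆ {i} ∈ 𝓕)
        then (1 : ℝ) else 0),
      sum_boole]
  -- the variance of `F` is `4 μ (1 − μ)`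
  have hmean : cubeFourierCoeff F ∅ = 1 - 2 * ((𝓕.card : ℝ) / 2 ^ n) := by
    unfold cubeFourierCoeff
    have hw : ∀ x : Fin n → Bool, F x * walsh ∅ x = 1 - 2 * (if (univ.filter fun j => x j = true) ∈ 𝓕
        then (1 : ℝ) else 0) := fun x => by
      rw [show walsh (∅ : Finset (Fin n)) x = 1 by simp [walsh], mul_one, hF_def]
      simp only; split_ifs <;> norm_num
    rw [sum_congr rfl fun x _ => hw x, sum_sub_distrib, ← mul_sum,
      sum_cube_eq_sum_powerset (fun A => if A ∈ 𝓕 then (1 : ℝ) else 0), sum_boole, sum_const,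
      card_univ, Fintype.card_fun, Fintype.card_bool, Fintype.card_fin, nsmul_eq_mul, mul_one]
    rw [show (univ.filter fun A : Finset (Fin n) => A ∈ 𝓕) = 𝓕 by ext A; simp]
    push_cast
    field_simp
  have hVar : Literature.Computability.Complexity.LowDegree.KKL.variance F =
      4 * ((𝓕.card : ℝ) / 2 ^ n) * (1 - (𝓕.card : ℝ) / 2 ^ n) := by
    rw [Literature.Computability.Complexity.LowDegree.KKL.variance_eq F hF, hmean]; ring
  rw [hInf, hVar] at hi
  convert hi using 1
  ring

end DischargeKKL

/-! ### §5 Discharge of `Friedgut1998_junta` (appended 2026-08-28; the Fourier-analytic core — O'Donnell's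
Theorem 9.28 and Friedgut's Junta Theorem — is `Literature.Computability.Complexity.LowDegree.KKL.friedgut_junta_exp`,
file `Computability/Complexity/FriedgutJuntaTheorem.lean`). As in §4 a family `𝓕 ⊆ P([n])` is read as the
`±1`-valued `pmIndicator 𝓕` on `{0,1}ⁿ`; its total influence in O'Donnell's sense is `I[𝓕] = |∂𝓕|/2^{n−1}`. -/

section DischargeFriedgut

open Literature.Computability.Complexity.LowDegree (cubeFourierCoeff)
open Literature.Probability.RandomGraphs.LowDegree (walsh)

/-- The `±1`-valued indicator of a family on the cube: `−1` on (the points of) `𝓕`, `+1` off it.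
[cite: EllisKellerLifshitz2018, §1 (p0005: Boolean function ↔ family {x : f(x) = 1})] -/
def pmIndicator (𝓕 : Finset (Finset (Fin n))) (x : Fin n → Bool) : ℝ :=
  if (univ.filter fun j => x j = true) ∈ 𝓕 then -1 else 1

/-- `pmIndicator` is `±1`-valued. [cite: EllisKellerLifshitz2018, §1 (p0005)] -/
theorem pmIndicator_eq_or (𝓕 : Finset (Finset (Fin n))) (x : Fin n → Bool) :
    pmIndicator 𝓕 x = 1 ∨ pmIndicator 𝓕 x = -1 := by
  unfold pmIndicator; split_ifs
  · exact Or.inr rfl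
  · exact Or.inl rfl

/-- The cube influence of `pmIndicator 𝓕` is `Inf_i[𝓕]`. [cite: EllisKellerLifshitz2018, §1 (p0004, Inf_i)] [cite: ODonnell2014, Def. 2.13] -/
theorem influence_pmIndicator (𝓕 : Finset (Finset (Fin n))) (i : Fin n) :
    Literature.Computability.Complexity.LowDegree.KKL.influence i (pmIndicator 𝓕) = influence i 𝓕 := by
  classical
  have hpt : ∀ x : Fin n → Bool,
      (if pmIndicator 𝓕 x ≠ pmIndicator 𝓕 (Function.update x i (!x i)) then (1 : ℝ) else 0) =
        if ((univ.filter fun j => x j = true) ∈ 𝓕 ∧ (univ.filter fun j => x j = true) ∆ {i} ∉ 𝓕) ∨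
            ((univ.filter fun j => x j = true) ∉ 𝓕 ∧ (univ.filter fun j => x j = true) ∆ {i} ∈ 𝓕)
          then (1 : ℝ) else 0 := by
    intro x
    simp only [pmIndicator, filter_update_not x i]
    by_cases h1 : (univ.filter fun j => x j = true) ∈ 𝓕 <;>
      by_cases h2 : (univ.filter fun j => x j = true) ∆ {i} ∈ 𝓕 <;> norm_num [h1, h2]
  unfold Literature.Computability.Complexity.LowDegree.KKL.influence influence
  congr 1
  rw [sum_congr rfl fun x _ => hpt x,
    sum_cube_eq_sum_powerset (fun A => if (A ∈ 𝓕 ∧ A ∆ {i} ∉ 𝓕) ∨ (A ∉ 𝓕 ∧ A ∆ {i} ∈ 𝓕)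
      then (1 : ℝ) else 0),
    sum_boole]

/-- `2ⁿ · Inf_i[𝓕] = 2 · |{A ∈ 𝓕 : A Δ {i} ∉ 𝓕}|` (the two endpoints of each dimension-`i` boundary edge).
[cite: EllisKellerLifshitz2018, §1 (p0004–p0005: Inf_i and I[𝓕] = |∂𝓕|/2^{n−1})] [cite: ODonnell2014, Fact 2.14] -/
theorem two_pow_mul_influence (𝓕 : Finset (Finset (Fin n))) (i : Fin n) :
    2 ^ n * influence i 𝓕 = 2 * ((𝓕.filter fun A => A ∆ {i} ∉ 𝓕).card : ℝ) := by
  classical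
  unfold influence
  rw [mul_div_cancel₀ _ (by positivity)]
  have hdisj : Disjoint (univ.filter fun A : Finset (Fin n) => A ∈ 𝓕 ∧ A ∆ {i} ∉ 𝓕)
      (univ.filter fun A : Finset (Fin n) => A ∉ 𝓕 ∧ A ∆ {i} ∈ 𝓕) :=
    disjoint_filter.2 fun A _ h1 h2 => h2.1 h1.1
  rw [filter_or, card_union_eq_card_add_card.2 hdisj, Nat.cast_add]
  have hP : (univ.filter fun A : Finset (Fin n) => A ∈ 𝓕 ∧ A ∆ {i} ∉ 𝓕) =
      𝓕.filter (fun A => A ∆ {i} ∉ 𝓕) := by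
    ext A; simp
  have hQ : ((univ.filter fun A : Finset (Fin n) => A ∉ 𝓕 ∧ A ∆ {i} ∈ 𝓕).card) =
      (𝓕.filter (fun A => A ∆ {i} ∉ 𝓕)).card := by
    refine card_nbij' (fun A => A ∆ {i}) (fun A => A ∆ {i}) ?_ ?_ ?_ ?_
    · intro A hA
      simp only [mem_coe, mem_filter, mem_univ, true_and] at hA ⊢
      rw [symmDiff_symmDiff_cancel_right]
      exact ⟨hA.2, hA.1⟩
    · intro A hA
      simp only [mem_coe, mem_filter, mem_univ, true_and] at hA ⊢
      rw [symmDiff_symmDiff_cancel_right]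
      exact ⟨hA.2, hA.1⟩
    · intro A _; exact symmDiff_symmDiff_cancel_right _ _
    · intro A _; exact symmDiff_symmDiff_cancel_right _ _
  rw [hP, hQ]
  ring

/-- **`I[𝓕] = Σ_i Inf_i[𝓕]`**: the normalised edge boundary `|∂𝓕|/2^{n−1}` is the total influence.
[cite: EllisKellerLifshitz2018, §1 (p0005) and §2 (p0007, I[𝓕] = |∂𝓕|/2^{n−1})] [cite: ODonnell2014, Def. 2.27] -/
theorem totalInfluence_eq_sum_influence (𝓕 : Finset (Finset (Fin n))) :
    totalInfluence 𝓕 = ∑ i, influence i 𝓕 := by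
  classical
  -- `|∂𝓕| = Σ_i |{A ∈ 𝓕 : A Δ {i} ∉ 𝓕}|`
  have hE : (edgeBoundary 𝓕 : ℝ) = ∑ i : Fin n, ((𝓕.filter fun A => A ∆ {i} ∉ 𝓕).card : ℝ) := by
    unfold edgeBoundary edgeBoundaryIn
    simp only [card_filter, Nat.cast_sum, Nat.cast_ite, Nat.cast_one, Nat.cast_zero]
    rw [sum_product, sum_comm]
  have h2 : (2 : ℝ) ^ n * ∑ i, influence i 𝓕 = 2 * edgeBoundary 𝓕 := by
    rw [mul_sum, hE, mul_sum]
    exact sum_congr rfl fun i _ => two_pow_mul_influence 𝓕 i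
  unfold totalInfluence
  rcases Nat.eq_zero_or_pos n with hn | hn
  · subst hn
    simp [edgeBoundary, edgeBoundaryIn]
  · obtain ⟨k, rfl⟩ := Nat.exists_eq_add_of_le hn
    rw [show 1 + k - 1 = k by omega]
    rw [show (2 : ℝ) ^ (1 + k) = 2 * 2 ^ k by ring] at h2
    have h2k : (0 : ℝ) < 2 ^ k := by positivity
    rw [div_eq_iff h2k.ne']
    nlinarith [h2]

/-- `I[pmIndicator 𝓕] = I[𝓕]`. [cite: EllisKellerLifshitz2018, §1 (p0005)] [cite: ODonnell2014, Def. 2.27] -/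
theorem totalInfluence_pmIndicator (𝓕 : Finset (Finset (Fin n))) :
    Literature.Computability.Complexity.LowDegree.KKL.totalInfluence (pmIndicator 𝓕) = totalInfluence 𝓕 := by
  rw [totalInfluence_eq_sum_influence]
  exact sum_congr rfl fun i _ => influence_pmIndicator 𝓕 i

/-- Reading a subset `A ⊆ [n]` as a point of the cube and back. [cite: EllisKellerLifshitz2018, §1 (p0003: {0,1}ⁿ ≅ P([n]))] -/
theorem decide_mem_filter_eq (x : Fin n → Bool) :
    (fun i => decide (i ∈ univ.filter fun j => x j = true)) = x := funext fun i => by simp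

/-- **Discharge of the named fact `Friedgut1998_junta` (Friedgut's junta theorem as quoted in
[EllisKellerLifshitz2018, Thm 1.7]), with `C = 17`**: for `ε ≥ 1` the empty family (a `0`-junta) is
`ε 2ⁿ`-close to anything; for `0 < ε < 1` read `𝓕` as `pmIndicator 𝓕`, apply
`KKL.friedgut_junta_exp` (`|J| ≤ 2^{17 I/ε}`, `Pr[F ≠ sgn F^{⊆J}] ≤ ε`, `I[F] = I[𝓕]`) and take
`𝓖 = {A : sgn F^{⊆J}(A) = −1}`, which depends only on the coordinates `J`.
[cite: Friedgut1998, pp. 27–35 (main theorem)] [cite: ODonnell2014, §9.6 (Friedgut's Junta Theorem, Thm. 9.28)]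
[cite: EllisKellerLifshitz2018, Thm 1.7 (p0005)] -/
theorem Friedgut1998_junta_holds : Friedgut1998_junta := by
  classical
  refine ⟨17, by norm_num, ?_⟩
  intro ε hε n 𝓕
  by_cases hε1 : 1 ≤ ε
  · -- `ε ≥ 1`: the empty family
    refine ⟨∅, ∅, fun T => by simp, ?_, ?_⟩
    · simp only [card_empty, Nat.cast_zero]; positivity
    · have h1 : (𝓕.card : ℝ) ≤ 2 ^ n := by
        have := card_le_univ 𝓕
        rw [Fintype.card_finset, Fintype.card_fin] at this
        exact_mod_cast this
      have h2 : 𝓕 ∆ ∅ = 𝓕 := by ext A; simp [mem_symmDiff]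
      rw [h2]
      calc (𝓕.card : ℝ) ≤ 2 ^ n := h1
        _ = 1 * 2 ^ n := (one_mul _).symm
        _ ≤ ε * 2 ^ n := by gcongr
  · rw [not_le] at hε1
    obtain ⟨J, hJ, hdist⟩ :=
      Literature.Computability.Complexity.LowDegree.KKL.friedgut_junta_exp (pmIndicator 𝓕)
        (pmIndicator_eq_or 𝓕) hε hε1.le
    rw [totalInfluence_pmIndicator] at hJ
    set h := Literature.Computability.Complexity.LowDegree.KKL.roundSign
      (Literature.Computability.Complexity.LowDegree.KKL.juntaPart J (pmIndicator 𝓕)) with hh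
    set 𝓖 : Finset (Finset (Fin n)) := univ.filter (fun A => h (fun i => decide (i ∈ A)) = -1) with h𝓖
    have mem𝓖 : ∀ x : Fin n → Bool, (univ.filter fun j => x j = true) ∈ 𝓖 ↔ h x = -1 := fun x => by
      rw [h𝓖, mem_filter, decide_mem_filter_eq x]; simp
    refine ⟨𝓖, J, ?_, ?_, ?_⟩
    · -- `𝓖` depends only on `J`
      intro T
      rw [h𝓖, mem_filter, mem_filter]
      simp only [mem_univ, true_and]
      rw [hh, Literature.Computability.Complexity.LowDegree.KKL.roundSign_juntaPart_eq_of_agree J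
        (pmIndicator 𝓕) (x := fun i => decide (i ∈ T)) (y := fun i => decide (i ∈ T ∩ J))
        (fun i hi => by simp [hi])]
    · -- `|J| ≤ 2^{17 I[𝓕]/ε}`
      rw [mul_div_assoc]; exact hJ
    · -- `|𝓕 Δ 𝓖| = 2ⁿ · Pr[F ≠ h] ≤ ε 2ⁿ`
      have h2n : (0 : ℝ) < 2 ^ n := by positivity
      rw [div_le_iff₀ h2n] at hdist
      refine le_trans (le_of_eq ?_) hdist
      have hpt : ∀ x : Fin n → Bool, (if pmIndicator 𝓕 x ≠ h x then (1 : ℝ) else 0) =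
          if (univ.filter fun j => x j = true) ∈ 𝓕 ∆ 𝓖 then (1 : ℝ) else 0 := by
        intro x
        have hhx : h x = 1 ∨ h x = -1 :=
          Literature.Computability.Complexity.LowDegree.KKL.roundSign_eq_or _ x
        simp only [mem_symmDiff, mem𝓖 x, pmIndicator]
        by_cases h1 : (univ.filter fun j => x j = true) ∈ 𝓕 <;> rcases hhx with h3 | h3 <;>
          norm_num [h1, h3]
      symm
      rw [sum_congr rfl fun x _ => hpt x,
        sum_cube_eq_sum_powerset (fun A => if A ∈ 𝓕 ∆ 𝓖 then (1 : ℝ) else 0), sum_boole,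
        filter_mem_eq_inter, univ_inter]

end DischargeFriedgut

/-! ### §6 Harper's edge-isoperimetric inequality, exact form: discharge of `Harper1964_edgeIso`
(appended 2026-08-28). The classical proof [Harper1964] (Bernstein 1967, Hart 1976; the statement is
[EllisKellerLifshitz2018, Thm 1.3]): with `h(m) = Σ_{k<m} s₂(k)` (`s₂` = binary digit sum; `h(m)` is the
number of edges of the cube spanned by the `m` smallest binary numbers), (a) every family of `m` subsets of
an `N`-set has `|∂𝓕| + 2h(m) ≥ N·m` — the induction of §1 along a coordinate, now closed by the exact
two-point inequality `h(a) + h(b) + min(a,b) ≤ h(a+b)` — and (b) the lexicographic initial segments attain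
equality, by induction along the MOST significant coordinate (`Finset.induction_on_min`), closed by
`h(2^k + m) = h(2^k) + h(m) + m` (`m ≤ 2^k`). -/

/-- The binary digit sum `s₂(k)` (number of `1`s in the binary expansion of `k`).
[cite: Harper1964, pp. 131–135 (Theorem 1: the maximal number of cube edges among m vertices is Σ_{k<m} s₂(k))] -/
def binWeight (k : ℕ) : ℕ := if h : k = 0 then 0 else k % 2 + binWeight (k / 2)
termination_by k
decreasing_by exact Nat.div_lt_self (Nat.pos_of_ne_zero h) one_lt_two

/-- `s₂(0) = 0`. [cite: Harper1964, pp. 131–135] -/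
theorem binWeight_zero : binWeight 0 = 0 := by
  rw [binWeight]; simp

/-- `s₂(2k) = s₂(k)`. [cite: Harper1964, pp. 131–135] -/
theorem binWeight_two_mul (k : ℕ) : binWeight (2 * k) = binWeight k := by
  rcases Nat.eq_zero_or_pos k with rfl | hk
  · simp [binWeight_zero]
  · rw [binWeight]
    rw [dif_neg (by omega)]
    simp [Nat.mul_mod_right, Nat.mul_div_cancel_left k two_pos]

/-- `s₂(2k+1) = s₂(k) + 1`. [cite: Harper1964, pp. 131–135] -/
theorem binWeight_two_mul_add_one (k : ℕ) : binWeight (2 * k + 1) = binWeight k + 1 := by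
  rw [binWeight, dif_neg (by omega)]
  have h1 : (2 * k + 1) % 2 = 1 := by omega
  have h2 : (2 * k + 1) / 2 = k := by omega
  rw [h1, h2, add_comm]

/-- **`h(m) = Σ_{k<m} s₂(k)`**: the number of edges of the cube spanned by the `m` smallest binary numbers
(= by the lexicographically largest `m` subsets, §2), Harper's extremal function.
[cite: Harper1964, pp. 131–135 (Theorem 1)] [cite: EllisKellerLifshitz2018, Thm 1.3 (p0004)] -/
def binEdgeCount (m : ℕ) : ℕ := ∑ k ∈ range m, binWeight k

/-- `h(0) = 0`. [cite: Harper1964, pp. 131–135] -/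
theorem binEdgeCount_zero : binEdgeCount 0 = 0 := by simp [binEdgeCount]

/-- `h(m+1) = h(m) + s₂(m)`. [cite: Harper1964, pp. 131–135] -/
theorem binEdgeCount_succ (m : ℕ) : binEdgeCount (m + 1) = binEdgeCount m + binWeight m := by
  simp [binEdgeCount, sum_range_succ]

/-- `h(2m) = 2h(m) + m` (two copies of the `m` smallest numbers plus the `m` rungs between them).
[cite: Harper1964, pp. 131–135] -/
theorem binEdgeCount_two_mul (m : ℕ) : binEdgeCount (2 * m) = 2 * binEdgeCount m + m := by
  induction m with
  | zero => simp [binEdgeCount_zero]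
  | succ m ih =>
    rw [show 2 * (m + 1) = 2 * m + 1 + 1 by ring, binEdgeCount_succ, binEdgeCount_succ, ih,
      binWeight_two_mul, binWeight_two_mul_add_one, binEdgeCount_succ]
    ring

/-- `h(2m+1) = h(m) + h(m+1) + m`. [cite: Harper1964, pp. 131–135] -/
theorem binEdgeCount_two_mul_add_one (m : ℕ) :
    binEdgeCount (2 * m + 1) = binEdgeCount m + binEdgeCount (m + 1) + m := by
  rw [binEdgeCount_succ, binEdgeCount_two_mul, binWeight_two_mul, binEdgeCount_succ]
  ring

/-- **The two-point inequality of the exact induction**: `h(a) + h(b) + min(a, b) ≤ h(a + b)` (strong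
induction on `a + b` through the parities of `a`, `b`). [cite: Harper1964, pp. 131–135 (the inductive argument)] -/
theorem binEdgeCount_superadditive : ∀ N a b : ℕ, a + b ≤ N →
    binEdgeCount a + binEdgeCount b + min a b ≤ binEdgeCount (a + b) := by
  intro N
  induction N using Nat.strong_induction_on with
  | _ N ih =>
    intro a b hab
    obtain ⟨α, rfl | rfl⟩ := Nat.even_or_odd' a <;> obtain ⟨β, rfl | rfl⟩ := Nat.even_or_odd' b
    · -- even / even
      rcases Nat.eq_zero_or_pos (α + β) with h0 | hpos
      · have : α = 0 := by omega
        have : β = 0 := by omega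
        subst_vars; simp [binEdgeCount_zero]
      have := ih (α + β) (by omega) α β le_rfl
      rw [show 2 * α + 2 * β = 2 * (α + β) by ring, binEdgeCount_two_mul, binEdgeCount_two_mul,
        binEdgeCount_two_mul]
      omega
    · -- even / odd
      rcases Nat.eq_zero_or_pos (α + β) with h0 | hpos
      · have : α = 0 := by omega
        have : β = 0 := by omega
        subst_vars; simp [binEdgeCount, binWeight_zero]
      have h1 := ih (α + β) (by omega) α β le_rfl
      have h2 := ih (α + β + 1) (by omega) α (β + 1) le_rfl
      rw [show 2 * α + (2 * β + 1) = 2 * (α + β) + 1 by ring, binEdgeCount_two_mul_add_one,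
        binEdgeCount_two_mul, binEdgeCount_two_mul_add_one]
      rw [show α + (β + 1) = α + β + 1 by ring] at h2
      omega
    · -- odd / even
      rcases Nat.eq_zero_or_pos (α + β) with h0 | hpos
      · have : α = 0 := by omega
        have : β = 0 := by omega
        subst_vars; simp [binEdgeCount, binWeight_zero]
      have h1 := ih (α + β) (by omega) α β le_rfl
      have h2 := ih (α + 1 + β) (by omega) (α + 1) β le_rfl
      rw [show 2 * α + 1 + 2 * β = 2 * (α + β) + 1 by ring, binEdgeCount_two_mul_add_one,
        binEdgeCount_two_mul, binEdgeCount_two_mul_add_one]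
      rw [show α + 1 + β = α + β + 1 by ring] at h2
      omega
    · -- odd / odd
      have h1 := ih (α + β + 1) (by omega) α (β + 1) (by omega)
      have h2 := ih (α + β + 1) (by omega) (α + 1) β (by omega)
      rw [show 2 * α + 1 + (2 * β + 1) = 2 * (α + β + 1) by ring, binEdgeCount_two_mul,
        binEdgeCount_two_mul_add_one, binEdgeCount_two_mul_add_one]
      rw [show α + (β + 1) = α + β + 1 by ring] at h1
      rw [show α + 1 + β = α + β + 1 by ring] at h2
      omega

/-- `s₂(2^k + j) = s₂(j) + 1` for `j < 2^k`. [cite: Harper1964, pp. 131–135] -/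
theorem binWeight_two_pow_add (k : ℕ) : ∀ j, j < 2 ^ k → binWeight (2 ^ k + j) = binWeight j + 1 := by
  induction k with
  | zero =>
    intro j hj
    have : j = 0 := by omega
    subst this
    rw [show 2 ^ 0 + 0 = 2 * 0 + 1 by norm_num, binWeight_two_mul_add_one]
  | succ k ih =>
    intro j hj
    obtain ⟨i, rfl | rfl⟩ := Nat.even_or_odd' j
    · rw [show 2 ^ (k + 1) + 2 * i = 2 * (2 ^ k + i) by ring, binWeight_two_mul, binWeight_two_mul,
        ih i (by rw [pow_succ] at hj; omega)]
    · rw [show 2 ^ (k + 1) + (2 * i + 1) = 2 * (2 ^ k + i) + 1 by ring, binWeight_two_mul_add_one,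
        binWeight_two_mul_add_one, ih i (by rw [pow_succ] at hj; omega)]

/-- `h(2^k + m) = h(2^k) + h(m) + m` for `m ≤ 2^k` (a full subcube, a segment of size `m`, and the `m`
rungs between them). [cite: Harper1964, pp. 131–135] -/
theorem binEdgeCount_two_pow_add (k m : ℕ) (hm : m ≤ 2 ^ k) :
    binEdgeCount (2 ^ k + m) = binEdgeCount (2 ^ k) + binEdgeCount m + m := by
  unfold binEdgeCount
  rw [sum_range_add, sum_congr rfl fun j hj => binWeight_two_pow_add k j (by
    have := mem_range.1 hj; omega), sum_add_distrib, sum_const, card_range, smul_eq_mul, mul_one]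
  ring

section GeneralExact

variable {α : Type*} [DecidableEq α]

/-- The edge boundary as a sum over the members of the number of boundary directions.
[cite: EllisKellerLifshitz2018, §1 (p0003)] -/
theorem edgeBoundaryIn_eq_sum (X : Finset α) (𝓕 : Finset (Finset α)) :
    edgeBoundaryIn X 𝓕 = ∑ S ∈ 𝓕, (X.filter fun i => S ∆ {i} ∉ 𝓕).card := by
  unfold edgeBoundaryIn
  rw [card_filter, sum_product]
  refine sum_congr rfl fun S _ => ?_
  rw [card_filter]

/-- **The exact splitting identity** (equality in `edgeBoundaryIn_insert_ge`): for `a ∉ X`, with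
`𝓕₀ = {S ∈ 𝓕 : a ∉ S}` and `𝓕₁ = {S ∖ {a} : S ∈ 𝓕, a ∈ S}`,
`|∂_{X ∪ {a}} 𝓕| = |∂_X 𝓕₀| + |∂_X 𝓕₁| + |𝓕₀ ∖ 𝓕₁| + |𝓕₁ ∖ 𝓕₀|`.
[cite: Harper1964, pp. 131–135 (the inductive argument)] -/
theorem edgeBoundaryIn_insert_eq {X : Finset α} {a : α} (ha : a ∉ X) (𝓕 : Finset (Finset α)) :
    edgeBoundaryIn (insert a X) 𝓕 =
      edgeBoundaryIn X (𝓕.filter fun S => a ∉ S) +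
        edgeBoundaryIn X ((𝓕.filter fun S => a ∈ S).image fun S => S.erase a) +
        ((𝓕.filter fun S => a ∉ S) \ ((𝓕.filter fun S => a ∈ S).image fun S => S.erase a)).card +
        (((𝓕.filter fun S => a ∈ S).image fun S => S.erase a) \ (𝓕.filter fun S => a ∉ S)).card := by
  classical
  set 𝓕₀ := 𝓕.filter fun S => a ∉ S with h𝓕₀_def
  set 𝓕₁ := (𝓕.filter fun S => a ∈ S).image fun S => S.erase a with h𝓕₁_def
  have mem0 : ∀ {S}, S ∈ 𝓕₀ ↔ S ∈ 𝓕 ∧ a ∉ S := fun {S} => by rw [h𝓕₀_def, mem_filter]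
  have mem1 : ∀ {T}, T ∈ 𝓕₁ ↔ a ∉ T ∧ insert a T ∈ 𝓕 := by
    intro T
    rw [h𝓕₁_def, mem_image]
    constructor
    · rintro ⟨S, hS, rfl⟩
      rw [mem_filter] at hS
      exact ⟨notMem_erase a S, by rw [insert_erase hS.2]; exact hS.1⟩
    · rintro ⟨haT, hT⟩
      exact ⟨insert a T, mem_filter.2 ⟨hT, mem_insert_self a T⟩, erase_insert haT⟩
  have hXa : ∀ {i}, i ∈ X → i ≠ a := fun {i} hi h => ha (h ▸ hi)
  have hinj : Set.InjOn (fun S : Finset α => S.erase a) ↑(𝓕.filter fun S => a ∈ S) :=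
    fun S hS T hT hST => by
      have haS : a ∈ S := (mem_filter.1 (mem_coe.1 hS)).2
      have haT : a ∈ T := (mem_filter.1 (mem_coe.1 hT)).2
      simpa [insert_erase haS, insert_erase haT] using congrArg (insert a) hST
  rw [edgeBoundaryIn_eq_sum, edgeBoundaryIn_eq_sum, edgeBoundaryIn_eq_sum]
  -- split off the direction `a`
  have hdir : ∀ S ∈ 𝓕, ((insert a X).filter fun i => S ∆ {i} ∉ 𝓕).card =
      (if S ∆ {a} ∉ 𝓕 then 1 else 0) + (X.filter fun i => S ∆ {i} ∉ 𝓕).card := by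
    intro S _
    rw [filter_insert]
    split_ifs with h
    · simp
    · rw [card_insert_of_notMem (fun h' => ha (mem_filter.1 h').1)]; omega
  rw [sum_congr rfl hdir, sum_add_distrib]
  -- the four pieces
  have hA0 : ∑ S ∈ 𝓕.filter (fun S => ¬ a ∈ S), (if S ∆ {a} ∉ 𝓕 then 1 else 0) = (𝓕₀ \ 𝓕₁).card := by
    rw [← h𝓕₀_def, sdiff_eq_filter, card_filter]
    refine sum_congr rfl fun S hS => ?_
    have haS : a ∉ S := (mem0.1 hS).2
    have hiff : S ∆ {a} ∉ 𝓕 ↔ ¬ S ∈ 𝓕₁ := by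
      rw [symmDiff_singleton_of_not_mem haS, mem1]
      exact ⟨fun h h' => h h'.2, fun h h' => h ⟨haS, h'⟩⟩
    simp only [hiff]
  have hA1 : ∑ S ∈ 𝓕.filter (fun S => a ∈ S), (if S ∆ {a} ∉ 𝓕 then 1 else 0) = (𝓕₁ \ 𝓕₀).card := by
    rw [sdiff_eq_filter, card_filter, h𝓕₁_def, sum_image hinj]
    refine sum_congr rfl fun S hS => ?_
    have haS : a ∈ S := (mem_filter.1 hS).2
    have hiff : S ∆ {a} ∉ 𝓕 ↔ ¬ S.erase a ∈ 𝓕₀ := by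
      rw [symmDiff_singleton_of_mem haS, mem0]
      exact ⟨fun h h' => h h'.1, fun h h' => h ⟨h', notMem_erase a S⟩⟩
    simp only [hiff]
  have hB0 : ∑ S ∈ 𝓕.filter (fun S => ¬ a ∈ S), (X.filter fun i => S ∆ {i} ∉ 𝓕).card =
      ∑ S ∈ 𝓕₀, (X.filter fun i => S ∆ {i} ∉ 𝓕₀).card := by
    rw [← h𝓕₀_def]
    refine sum_congr rfl fun S hS => ?_
    have haS : a ∉ S := (mem0.1 hS).2
    congr 1
    refine filter_congr fun i hi => ?_
    rw [mem0]
    exact ⟨fun h h' => h h'.1, fun h h' => h ⟨h', not_mem_symmDiff_singleton haS (hXa hi)⟩⟩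
  have hB1 : ∑ S ∈ 𝓕.filter (fun S => a ∈ S), (X.filter fun i => S ∆ {i} ∉ 𝓕).card =
      ∑ T ∈ 𝓕₁, (X.filter fun i => T ∆ {i} ∉ 𝓕₁).card := by
    rw [h𝓕₁_def, sum_image hinj]
    refine sum_congr rfl fun S hS => ?_
    have haS : a ∈ S := (mem_filter.1 hS).2
    congr 1
    refine filter_congr fun i hi => ?_
    have hT : a ∉ S.erase a := notMem_erase a S
    rw [mem1]
    constructor
    · intro h h'
      apply h
      have := h'.2
      rwa [← insert_symmDiff_singleton (hXa hi), insert_erase haS] at this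
    · intro h h'
      apply h
      refine ⟨not_mem_symmDiff_singleton hT (hXa hi), ?_⟩
      rwa [← insert_symmDiff_singleton (hXa hi), insert_erase haS]
  rw [← sum_filter_add_sum_filter_not 𝓕 (fun S => a ∈ S) (fun S => if S ∆ {a} ∉ 𝓕 then 1 else 0),
    ← sum_filter_add_sum_filter_not 𝓕 (fun S => a ∈ S)
      (fun S => (X.filter fun i => S ∆ {i} ∉ 𝓕).card),
    hA0, hA1, hB0, hB1]
  ring

/-- **The exact lower bound** `N · |𝓕| ≤ |∂𝓕| + 2 h(|𝓕|)` for families of subsets of an `N`-set `X`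
(the number of inner edges is at most `h(|𝓕|)`). [cite: Harper1964, pp. 131–135 (Theorem 1)]
[cite: EllisKellerLifshitz2018, Thm 1.3 (p0004)] -/
theorem card_mul_card_le_edgeBoundaryIn_add (X : Finset α) :
    ∀ 𝓕 : Finset (Finset α), (∀ S ∈ 𝓕, S ⊆ X) →
      X.card * 𝓕.card ≤ edgeBoundaryIn X 𝓕 + 2 * binEdgeCount 𝓕.card := by
  classical
  induction X using Finset.induction_on with
  | empty =>
    intro 𝓕 _
    simp
  | insert a X ha ih =>
    intro 𝓕 h𝓕
    set 𝓕₀ := 𝓕.filter fun S => a ∉ S with h𝓕₀_def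
    set 𝓕₁ := (𝓕.filter fun S => a ∈ S).image fun S => S.erase a with h𝓕₁_def
    have h0X : ∀ S ∈ 𝓕₀, S ⊆ X := fun S hS => by
      rw [h𝓕₀_def, mem_filter] at hS
      exact (subset_insert_iff_of_notMem hS.2).1 (h𝓕 S hS.1)
    have h1X : ∀ S ∈ 𝓕₁, S ⊆ X := fun S hS => by
      rw [h𝓕₁_def, mem_image] at hS
      obtain ⟨T, hT, rfl⟩ := hS
      rw [mem_filter] at hT
      intro x hx
      rw [mem_erase] at hx
      exact mem_of_mem_insert_of_ne (h𝓕 T hT.1 hx.2) hx.1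
    have ih0 := ih 𝓕₀ h0X
    have ih1 := ih 𝓕₁ h1X
    have hsplit : edgeBoundaryIn X 𝓕₀ + edgeBoundaryIn X 𝓕₁ + (𝓕₀ \ 𝓕₁).card + (𝓕₁ \ 𝓕₀).card ≤
        edgeBoundaryIn (insert a X) 𝓕 := edgeBoundaryIn_insert_ge ha 𝓕
    have hc1 : 𝓕₁.card = (𝓕.filter fun S => a ∈ S).card := by
      rw [h𝓕₁_def]
      exact card_image_of_injOn fun S hS T hT hST => by
        have haS : a ∈ S := (mem_filter.1 (mem_coe.1 hS)).2
        have haT : a ∈ T := (mem_filter.1 (mem_coe.1 hT)).2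
        simpa [insert_erase haS, insert_erase haT] using congrArg (insert a) hST
    have hsum : 𝓕.card = 𝓕₀.card + 𝓕₁.card := by
      rw [hc1, h𝓕₀_def, add_comm, card_filter_add_card_filter_not]
    have hXcard : (insert a X).card = X.card + 1 := card_insert_of_notMem ha
    have hd0 : 𝓕₀.card ≤ (𝓕₀ \ 𝓕₁).card + 𝓕₁.card := card_le_card_sdiff_add_card
    have hd1 : 𝓕₁.card ≤ (𝓕₁ \ 𝓕₀).card + 𝓕₀.card := card_le_card_sdiff_add_card
    have hkey := binEdgeCount_superadditive _ 𝓕₀.card 𝓕₁.card le_rfl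
    rw [hsum, hXcard]
    rcases le_total 𝓕₀.card 𝓕₁.card with h | h
    · rw [min_eq_left h] at hkey
      nlinarith [ih0, ih1, hsplit, hd1, hkey]
    · rw [min_eq_right h] at hkey
      nlinarith [ih0, ih1, hsplit, hd0, hkey]

end GeneralExact

/-- **`𝓛` is an initial segment of the lexicographic order inside `P(X)`** (`X ⊆ [n]`): all members lie
in `P(X)` and with each member `𝓛` contains every lexicographically larger subset of `X`; for `X = [n]`
this is `IsLexInitialSegment`. [cite: EllisKellerLifshitz2018, §1 (p0003) and §2 (p0007)] -/
def IsLexSegmentIn (X : Finset (Fin n)) (𝓛 : Finset (Finset (Fin n))) : Prop :=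
  (∀ S ∈ 𝓛, S ⊆ X) ∧ ∀ S ∈ 𝓛, ∀ T : Finset (Fin n), T ⊆ X → LexGT T S → T ∈ 𝓛

/-- `S ∪ {a} > S` for `a ∉ S`. [cite: EllisKellerLifshitz2018, §1 (p0003, definition of the order)] -/
theorem lexGT_insert_self {S : Finset (Fin n)} {a : Fin n} (ha : a ∉ S) : LexGT (insert a S) S := by
  have hset : insert a S ∆ S = {a} := by
    ext x
    simp only [Finset.mem_symmDiff, mem_insert, mem_singleton]
    constructor
    · rintro (⟨rfl | hx, hnx⟩ | ⟨hx, hnx⟩)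
      · rfl
      · exact absurd hx hnx
      · exact absurd (Or.inr hx) hnx
    · rintro rfl
      exact Or.inl ⟨Or.inl rfl, ha⟩
  have hne : (insert a S ∆ S).Nonempty := by rw [hset]; exact singleton_nonempty a
  refine ⟨hne, ?_⟩
  have : (insert a S ∆ S).min' hne = a := by
    apply le_antisymm
    · exact min'_le _ _ (by rw [hset]; exact mem_singleton_self a)
    · exact le_min' _ _ _ fun y hy => by rw [hset, mem_singleton] at hy; rw [hy]
  rw [this]
  exact mem_insert_self a S

/-- If `a ∈ T`, `a ∉ S` and `a` is below every element of `T Δ S`, then `T > S`.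
[cite: EllisKellerLifshitz2018, §1 (p0003)] -/
theorem lexGT_of_forall_le {T S : Finset (Fin n)} {a : Fin n} (haT : a ∈ T) (haS : a ∉ S)
    (hmin : ∀ x ∈ T ∆ S, a ≤ x) : LexGT T S := by
  have hmem : a ∈ T ∆ S := Finset.mem_symmDiff.2 (Or.inl ⟨haT, haS⟩)
  refine ⟨⟨a, hmem⟩, ?_⟩
  have : (T ∆ S).min' ⟨a, hmem⟩ = a := le_antisymm (min'_le _ _ hmem) (le_min' _ _ _ hmin)
  rw [this]
  exact haT

/-- Adding a common new element preserves the order: `T > S ⇒ T ∪ {a} > S ∪ {a}` (`a ∉ T ∪ S`).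
[cite: EllisKellerLifshitz2018, §1 (p0003)] -/
theorem lexGT_insert_insert {T S : Finset (Fin n)} {a : Fin n} (haT : a ∉ T) (haS : a ∉ S)
    (h : LexGT T S) : LexGT (insert a T) (insert a S) := by
  have hset : insert a T ∆ insert a S = T ∆ S := by
    ext x
    simp only [Finset.mem_symmDiff, mem_insert]
    constructor
    · rintro (⟨rfl | hx, hnx⟩ | ⟨rfl | hx, hnx⟩)
      · exact absurd (Or.inl rfl) hnx
      · exact Or.inl ⟨hx, fun h => hnx (Or.inr h)⟩
      · exact absurd (Or.inl rfl) hnx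
      · exact Or.inr ⟨hx, fun h => hnx (Or.inr h)⟩
    · rintro (⟨hx, hnx⟩ | ⟨hx, hnx⟩)
      · exact Or.inl ⟨Or.inr hx, fun h => h.elim (fun h => haT (h ▸ hx)) hnx⟩
      · exact Or.inr ⟨Or.inr hx, fun h => h.elim (fun h => haS (h ▸ hx)) hnx⟩
  obtain ⟨hne, hmin⟩ := h
  have hne' : (insert a T ∆ insert a S).Nonempty := by rw [hset]; exact hne
  refine ⟨hne', ?_⟩
  have : (insert a T ∆ insert a S).min' hne' = (T ∆ S).min' hne := by congr 1
  rw [this]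
  exact mem_insert_of_mem hmin

/-- **Lexicographic initial segments attain `N · |𝓛| = |∂𝓛| + 2 h(|𝓛|)`** inside `P(X)`, `|X| = N`
(induction along the most significant coordinate `a = min X`: either every member contains `a`, or the
members containing `a` form the full subcube). [cite: Harper1964, pp. 131–135 (Theorem 1, the extremal sets)]
[cite: EllisKellerLifshitz2018, Thm 1.3 (p0004) and §1 (p0003, initial segments of size 2^d are subcubes)] -/
theorem edgeBoundaryIn_lexSegment (X : Finset (Fin n)) :
    ∀ 𝓛 : Finset (Finset (Fin n)), IsLexSegmentIn X 𝓛 →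
      edgeBoundaryIn X 𝓛 + 2 * binEdgeCount 𝓛.card = X.card * 𝓛.card := by
  classical
  induction X using Finset.induction_on_min with
  | empty =>
    intro 𝓛 h𝓛
    have hsub : 𝓛 ⊆ {∅} := fun S hS => mem_singleton.2 (subset_empty.1 (h𝓛.1 S hS))
    have hc : 𝓛.card ≤ 1 := by simpa using card_le_card hsub
    have hb : edgeBoundaryIn (∅ : Finset (Fin n)) 𝓛 = 0 := by simp [edgeBoundaryIn]
    rw [hb, card_empty, zero_mul]
    interval_cases h : 𝓛.card <;> simp [binEdgeCount, binWeight_zero]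
  | insert a X haX ih =>
    intro 𝓛 h𝓛
    have ha : a ∉ X := fun h => lt_irrefl a (haX a h)
    obtain ⟨h𝓛X, h𝓛up⟩ := h𝓛
    set 𝓛₀ := 𝓛.filter fun S => a ∉ S with h𝓛₀_def
    set 𝓛₁ := (𝓛.filter fun S => a ∈ S).image fun S => S.erase a with h𝓛₁_def
    have mem0 : ∀ {S}, S ∈ 𝓛₀ ↔ S ∈ 𝓛 ∧ a ∉ S := fun {S} => by rw [h𝓛₀_def, mem_filter]
    have mem1 : ∀ {T}, T ∈ 𝓛₁ ↔ a ∉ T ∧ insert a T ∈ 𝓛 := by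
      intro T
      rw [h𝓛₁_def, mem_image]
      constructor
      · rintro ⟨S, hS, rfl⟩
        rw [mem_filter] at hS
        exact ⟨notMem_erase a S, by rw [insert_erase hS.2]; exact hS.1⟩
      · rintro ⟨haT, hT⟩
        exact ⟨insert a T, mem_filter.2 ⟨hT, mem_insert_self a T⟩, erase_insert haT⟩
    have h0X : ∀ S ∈ 𝓛₀, S ⊆ X := fun S hS => by
      obtain ⟨hS𝓛, haS⟩ := mem0.1 hS
      exact (subset_insert_iff_of_notMem haS).1 (h𝓛X S hS𝓛)
    have h1X : ∀ S ∈ 𝓛₁, S ⊆ X := fun S hS => by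
      obtain ⟨haS, hins⟩ := mem1.1 hS
      intro x hx
      exact mem_of_mem_insert_of_ne (h𝓛X _ hins (mem_insert_of_mem hx)) fun h => haS (h ▸ hx)
    -- the two halves are segments in `P(X)`, and `𝓛₀ ⊆ 𝓛₁`
    have hseg0 : IsLexSegmentIn X 𝓛₀ := ⟨h0X, fun S hS T hTX hTS => by
      obtain ⟨hS𝓛, -⟩ := mem0.1 hS
      exact mem0.2 ⟨h𝓛up S hS𝓛 T (hTX.trans (subset_insert a X)) hTS, fun haT => ha (hTX haT)⟩⟩
    have hseg1 : IsLexSegmentIn X 𝓛₁ := ⟨h1X, fun S hS T hTX hTS => by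
      obtain ⟨haS, hins⟩ := mem1.1 hS
      have haT : a ∉ T := fun h => ha (hTX h)
      exact mem1.2 ⟨haT, h𝓛up _ hins _ (insert_subset_insert a hTX)
        (lexGT_insert_insert haT haS hTS)⟩⟩
    have h01 : 𝓛₀ ⊆ 𝓛₁ := fun S hS => by
      obtain ⟨hS𝓛, haS⟩ := mem0.1 hS
      exact mem1.2 ⟨haS, h𝓛up S hS𝓛 _ (insert_subset_insert a (h0X S hS)) (lexGT_insert_self haS)⟩
    have ih0 := ih 𝓛₀ hseg0
    have ih1 := ih 𝓛₁ hseg1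
    have hsplit : edgeBoundaryIn (insert a X) 𝓛 =
        edgeBoundaryIn X 𝓛₀ + edgeBoundaryIn X 𝓛₁ + (𝓛₀ \ 𝓛₁).card + (𝓛₁ \ 𝓛₀).card :=
      edgeBoundaryIn_insert_eq ha 𝓛
    have hc1 : 𝓛₁.card = (𝓛.filter fun S => a ∈ S).card := by
      rw [h𝓛₁_def]
      exact card_image_of_injOn fun S hS T hT hST => by
        have haS : a ∈ S := (mem_filter.1 (mem_coe.1 hS)).2
        have haT : a ∈ T := (mem_filter.1 (mem_coe.1 hT)).2
        simpa [insert_erase haS, insert_erase haT] using congrArg (insert a) hST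
    have hsum : 𝓛.card = 𝓛₀.card + 𝓛₁.card := by
      rw [hc1, h𝓛₀_def, add_comm, card_filter_add_card_filter_not]
    have hXcard : (insert a X).card = X.card + 1 := card_insert_of_notMem ha
    have hd01 : (𝓛₀ \ 𝓛₁).card = 0 := by rw [sdiff_eq_empty_iff_subset.2 h01, card_empty]
    have hd10 : (𝓛₁ \ 𝓛₀).card + 𝓛₀.card = 𝓛₁.card := card_sdiff_add_card_eq_card h01
    rw [hsum, hXcard]
    rcases 𝓛₀.eq_empty_or_nonempty with h0e | h0ne
    · -- every member contains `a`
      have hc0 : 𝓛₀.card = 0 := by rw [h0e, card_empty]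
      have he0 : edgeBoundaryIn X 𝓛₀ = 0 := by rw [h0e]; simp [edgeBoundaryIn]
      rw [hc0, zero_add]
      rw [hc0] at hd10
      linarith [hsplit, ih1, hd01, hd10, he0]
    · -- some member misses `a`: then the members containing `a` form all of `P(X) ∪ {a}`
      have hP : 𝓛₁ = X.powerset := by
        refine Subset.antisymm (fun T hT => mem_powerset.2 (h1X T hT)) fun T hT => ?_
        rw [mem_powerset] at hT
        obtain ⟨S, hS⟩ := h0ne
        obtain ⟨hS𝓛, haS⟩ := mem0.1 hS
        have haT : a ∉ T := fun h => ha (hT h)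
        refine mem1.2 ⟨haT, h𝓛up S hS𝓛 _ (insert_subset_insert a hT)
          (lexGT_of_forall_le (mem_insert_self a T) haS fun x hx => ?_)⟩
        have hx' : x ∈ insert a X := by
          rw [Finset.mem_symmDiff] at hx
          rcases hx with ⟨hx, -⟩ | ⟨hx, -⟩
          · exact insert_subset_insert a hT hx
          · exact mem_insert_of_mem (h0X S hS hx)
        rcases mem_insert.1 hx' with rfl | hxX
        · exact le_rfl
        · exact (haX x hxX).le
      have hPseg : IsLexSegmentIn X X.powerset :=
        ⟨fun S hS => mem_powerset.1 hS, fun S _ T hT _ => mem_powerset.2 hT⟩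
      have hc1' : 𝓛₁.card = 2 ^ X.card := by rw [hP, card_powerset]
      have hm0 : 𝓛₀.card ≤ 2 ^ X.card := by
        calc 𝓛₀.card ≤ X.powerset.card := card_le_card fun S hS => mem_powerset.2 (h0X S hS)
          _ = 2 ^ X.card := card_powerset X
      have hkey := binEdgeCount_two_pow_add X.card 𝓛₀.card hm0
      rw [hc1'] at ih1 hd10 ⊢
      rw [add_comm 𝓛₀.card (2 ^ X.card), hkey]
      nlinarith [hsplit, ih0, ih1, hd01, hd10, hkey]

/-- **Discharge of the named fact `Harper1964_edgeIso` (the edge-isoperimetric inequality in the cube,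
[EllisKellerLifshitz2018, Thm 1.3] = Harper 1964 / Lindsey / Bernstein / Hart)**: an initial segment `𝓛` of
the lexicographic order with `|𝓛| = |𝓕|` has `|∂𝓛| = n|𝓕| − 2h(|𝓕|) ≤ |∂𝓕|`.
[cite: Harper1964, pp. 131–135 (Theorem 1)] [cite: EllisKellerLifshitz2018, Thm 1.3 (p0004)] -/
theorem Harper1964_edgeIso_holds : Harper1964_edgeIso := by
  intro n 𝓕 𝓛 h𝓛 hcard
  classical
  have hA := card_mul_card_le_edgeBoundaryIn_add (univ : Finset (Fin n)) 𝓕 fun S _ => subset_univ S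
  have hB := edgeBoundaryIn_lexSegment (univ : Finset (Fin n)) 𝓛
    ⟨fun S _ => subset_univ S, fun S hS T _ hTS => h𝓛 S hS T hTS⟩
  unfold edgeBoundary
  rw [hcard] at hB
  omega


end CubeEdgeIsoperimetry

end Literature.Combinatorics.SetFamily
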